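import Literature.Analysis.FluidPDE.PassiveVectorTensorDistortedConstFrameFourier
import Literature.Analysis.FluidPDE.PassiveVectorTensorTwistedModalSymbol
import Literature.Analysis.FluidPDE.PassiveVectorTensorModeEnergy
import HarnessLib

/-!
# The distorted weak class with a CONSTANT frame `G ≡ G₀`: the energy identity of one Fourier mode
# and the modewise dissipation bound (frozen-frame twin of `PassiveVectorTensorModeEnergy`)

Analysis/FluidPDE proof-support file (everything proved; no definitions, no named facts). First brick
(layer L3, file 1/5) of the Fourier–Galerkin energy argument ON THE WEAK SOLUTION ITSELF for the
`G`-distorted weak class `Torus.IsWeakTensorPassiveVectorDistortedOn A T 𝔸 b G w₀ w` of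
`PassiveVectorTensorDistorted.lean` (`∂ₜw + (b·∇)w + A (w·∇)b + Gᵀ∇π = 𝓛^G w`, `∇·(G w) = 0`) with a
CONSTANT frame `G = fun _ _ => G₀` (a fixed real matrix).  By `PassiveVectorTensorDistortedConstFrameFourier`
the frozen frame twists only the fibre geometry at each integer wave vector `k`: the constraint plane
`k^⊥` becomes the plane orthogonal to the TWISTED frequency `twistFreq G₀ k = G₀ᵀk`
(`PassiveVectorTensorTwistedModalSymbol`), and the plane-wave symbol is that of the conjugated tensor
`𝔸^{G₀} = Visc4.conj G₀ 𝔸`, `T_{𝔸^{G₀}}(k) = Torus.symbT (Visc4.conj G₀ 𝔸) k`, which in a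
Legendre–Hadamard window `NearIso 𝔸 lo hi` is coercive on the twisted plane,
`lo |G₀ᵀk|² ‖z‖² ≤ Re ⟪z, T_{𝔸^{G₀}}(k) z⟫` (`lo_mul_le_re_inner_symbT_conj`).  With these two
substitutions the flat file `PassiveVectorTensorModeEnergy` ports verbatim:

* §1 (any frame `G`) the kinematic mode API of the flat file for the distorted class: essential
  boundedness of the modes and of the mode pairings, integrability on `(0,T)` of `|⟪ŵ(τ)(k), z⟫|²`,
  `‖ŵ(τ)(k)‖²`, `⟪ŵ(τ)(k), T_𝔹(k) ŵ(τ)(k)⟫` (any tensor `𝔹`), of the transport form `B_τ(z)`, the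
  Plancherel slice bounds for the products `bⱼw`, `wⱼb` with a carrier bounded by `M`
  (`ae_tsum_enorm_sq_mFourierCoeff_products_le`) and of the flux energies `γ_k`;
* §2 (constant frame) `ae_mode_energy_eq_constFrame` — physical-space form of the per-mode energy
  identity for a steady smooth test field `Γ` with `∇·(G₀ Γ) = 0`;
  `ae_sq_norm_inner_mFourierCoeff_eq_constFrame` — tested form, `z` transversal to `G₀ᵀk`;
  `ae_mFourierCoeff_zero_eq_constFrame` — the zero mode is conserved;
  **`ae_sq_norm_mFourierCoeff_eq_constFrame`** — the energy identity of one mode, vector form: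
  for a datum `w₀ ∈ L²` with `∇·(G₀ w₀) = 0` weakly, every `k` and a.e. `t ∈ (0,T)`,
  `‖ŵ(t)(k)‖² = ‖ŵ₀(k)‖² + 2 ∫_{(0,t]} Re (−4π² ⟪ŵ(τ)(k), T_{𝔸^{G₀}}(k) ŵ(τ)(k)⟫ + B_τ(ŵ(τ)(k))) dτ`
  (tested identities summed over an orthonormal basis of `(G₀ᵀk)^⊥ ⊂ ℂ^d`, where the modes of `w` and
  `w₀` lie);
  **`ae_sq_norm_add_dissipation_le_constFrame`** — the modewise dissipation bound in a window
  `NearIso 𝔸 lo hi`, `0 < lo`, for a NON-DEGENERATE frame, `c |k|² ≤ |G₀ᵀk|²` for all `k` with `0 < c`,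
  and a carrier bounded by `M`:
  `‖ŵ(t)(k)‖² + 4π² lo |G₀ᵀk|² ∫_{(0,t]} ‖ŵ(τ)(k)‖² dτ ≤ ‖ŵ₀(k)‖² + ((1+A²)/(lo c)) ∫_{(0,t]} γ_k`
  (Robinson–Rodrigo–Sadowski 2016, (4.20), mode by mode, `ν|k|² ↦ lo|G₀ᵀk|²`);
* §0 the fibre bookkeeping used above: `mem_orthogonal_waveVecRC_iff`, `twistFreq_zero`,
  `rdot_twistFreq_mFourierCoeff_eq_zero_of_isWeaklyDivFree_distort` (the distorted constraint of an
  `L²` field mode by mode), `sum_twistFreq_one_sq` (`|1ᵀk|² = |k|²`), and the frame constants of an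
  entrywise-small distortion: `|G₀ − 1| ≤ θ` entrywise with `card d · θ ≤ 1` gives
  `(1 − card d·θ)² |k|² ≤ |G₀ᵀk|² ≤ (1 + card d·θ)² |k|²`
  (`sq_one_sub_mul_freqNormSq_le_sum_twistFreq_sq`, `sum_twistFreq_sq_le_sq_one_add_mul_freqNormSq`).

This is the y-space reading of the frozen-frame cell problem of Armstrong–Vicol's Lagrangian-coordinate
ansatz (arXiv:2305.05048 §4.1, the distortion `s_{m−1}` frozen).  Cell `ad-ideate`, route
`SolenoidalFractalHomogenisation`, K1L_D stmt-AnomalousDissipation-27980, road of record D28-7 layer L3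
(«frozen-frame energy of every weak solution») towards the registered stub `stub_D1_V0θg`; sibling of
N1 `FrozenDistortedExists`.  NOT here: truncated identity, tails, finite dissipation, energy
inequality/decay (files 2–5 of the layer).

## Mathlib / tree search

Tree: `PassiveVectorTensorModeEnergy` (flat twin, verbatim; `continuous_symbT`, `exists_norm_symbT_le`),
`PassiveVectorTensorDistortedConstFrameFourier` (`ae_inner_mFourierCoeff_eq_constFrame`,
`ae_integral_inner_eq_constFrame`, `ae_sum_vecMul_mul_mFourierCoeff_eq_zero`, `mFourierCoeff_distort_const`,
D-class mode integrability), `PassiveVectorTensorTwistedModalSymbol` (`twistFreq`, `rdot`, `waveVecRC`,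
`inner_waveVecRC_left`, `lo_mul_le_re_inner_symbT_conj`), `PassiveVectorTensorDistortedDuality`
(`integrable_inner_of_continuous`, `integrable_inner_convect`, `integrable_inner_carrier_convect`),
`PassiveVectorUniqueness` (`tsum_enorm_sq_mFourierCoeff_le_of_norm_le`), `TorusTrigPoly`
(`IsWeaklyDivFree.sum_mul_mFourierCoeff_eq_zero`), `PassiveScalarEnergyMollified.sq_const_add_setIntegral_eq`.
`rg "DistortedOn" Literature/Analysis/FluidPDE -l`: no energy statement for the distorted class existed.

## References

* J. C. Robinson, J. L. Rodrigo, W. Sadowski, *The three-dimensional Navier–Stokes equations*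
  (CUP 2016), §4.2 (Galerkin energy estimate (4.20)), Ex. 2.14. [`RobinsonRodrigoSadowski2016`]
* S. Armstrong, V. Vicol, *Anomalous diffusion by fractal homogenization*, Ann. PDE 11 (2025) /
  arXiv:2305.05048, §4.1 (PDF p. 34). [`ArmstrongVicol2025`]
* U. Frisch, *Turbulence* (CUP 1995), §9.6.3 eq. (9.57) p. 233. [`Frisch1995Turbulence`]
* M. Giaquinta, *Multiple integrals in the calculus of variations and nonlinear elliptic systems*
  (Princeton 1983), Ch. III §2 (2.2). [`Giaquinta1983MultipleIntegrals`]
* R. J. DiPerna, P.-L. Lions, Invent. Math. 98 (1989), §II.1, (12)–(14). [`DiPernaLions1989`]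
* R. Temam, *Navier–Stokes Equations* (1984), Ch. III §1.1. [`Temam1984`]
* L. Grafakos, *Classical Fourier Analysis* (3rd ed., 2014), Prop. 3.2.7. [`Grafakos2014`]
-/

noncomputable section

open MeasureTheory Set Filter Function TopologicalSpace Complex UnitAddTorus
open scoped ENNReal NNReal InnerProductSpace ComplexConjugate

namespace Literature.Analysis.FluidPDE

namespace Torus

variable {d : Type*} [Fintype d]

/-! ## §0 Fibre bookkeeping: the twisted plane, the zero mode, frame constants -/

section Fibre

variable [DecidableEq d]

omit [DecidableEq d] in
/-- Membership in the twisted transversal subspace `(ℂ q)^⊥` is the twisted divergence condition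
`q · z = 0`. [cite: Temam1984, Ch. III §1.1] -/
theorem mem_orthogonal_waveVecRC_iff (q : d → ℝ) (z : EuclideanSpace ℂ d) :
    z ∈ (ℂ ∙ waveVecRC q)ᗮ ↔ rdot q z = 0 := by
  rw [Submodule.mem_orthogonal_singleton_iff_inner_right, inner_waveVecRC_left]

omit [DecidableEq d] in
/-- The zero mode is not twisted: `twistFreq G₀ 0 = 0`. [cite: ArmstrongVicol2025, §4.1 (PDF p. 34)] -/
@[simp] theorem twistFreq_zero (G₀ : Matrix d d ℝ) : twistFreq G₀ (0 : d → ℤ) = 0 := by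
  funext b'
  simp [twistFreq_apply]

omit [DecidableEq d] in
/-- Every vector is transversal to the zero covector: `rdot 0 z = 0`. [cite: Temam1984, Ch. III §1.1] -/
@[simp] theorem rdot_zero_left (z : EuclideanSpace ℂ d) : rdot (0 : d → ℝ) z = 0 := by
  simp [rdot_apply]

omit [DecidableEq d] in
/-- The identity frame: `|1ᵀk|² = |k|²`, i.e. `Σ_a (twistFreq 1 k a)² = freqNormSq k`.
[cite: ArmstrongVicol2025, §4.1 (PDF p. 34)] -/
theorem sum_twistFreq_one_sq [DecidableEq d] (k : d → ℤ) :
    ∑ a, twistFreq (1 : Matrix d d ℝ) k a ^ 2 = FunctionSpaces.Torus.freqNormSq k := by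
  rw [twistFreq_one, FunctionSpaces.Torus.freqNormSq]

/-- **The distorted constraint of an `L²` field, mode by mode (constant frame).** If `v ∈ L²` and
`∇·(G₀ v) = 0` weakly, then every Fourier mode of `v` is transversal to the twisted frequency:
`(G₀ᵀk) · v̂(k) = 0` (`𝓕(G₀ • v) = G₀ • v̂`, Robinson–Rodrigo–Sadowski Ex. 2.14).
[cite: RobinsonRodrigoSadowski2016, Ex. 2.14 (solution p. 310)] [cite: ArmstrongVicol2025, §4.1 (PDF p. 34)] -/
theorem rdot_twistFreq_mFourierCoeff_eq_zero_of_isWeaklyDivFree_distort (G₀ : Matrix d d ℝ)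
    {v : UnitAddTorus d → EuclideanSpace ℝ d} (hv : MemLp v 2 volume)
    (hdiv : FunctionSpaces.Torus.IsWeaklyDivFree (distort (fun _ => G₀) v)) (k : d → ℤ) :
    rdot (twistFreq G₀ k) (mFourierCoeff (FunctionSpaces.EuclideanSpace.complexify ∘ v) k) = 0 := by
  have h2' : MemLp (distort (fun _ => G₀) v) 2 volume := by
    have e : distort (fun (_ : UnitAddTorus d) => G₀) v =
        fun x => (Matrix.toEuclideanCLM (n := d) (𝕜 := ℝ) G₀) (v x) := by
      funext x
      ext a
      rw [distort_apply, show Matrix.toEuclideanCLM (n := d) (𝕜 := ℝ) G₀ (v x) a =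
        WithLp.ofLp (Matrix.toEuclideanCLM (n := d) (𝕜 := ℝ) G₀ (v x)) a from rfl, Matrix.ofLp_toEuclideanCLM]
      simp [Matrix.mulVec, dotProduct]
    rw [e]
    exact ContinuousLinearMap.comp_memLp' _ hv
  have key := FunctionSpaces.Torus.IsWeaklyDivFree.sum_mul_mFourierCoeff_eq_zero h2' hdiv k
  rw [mFourierCoeff_distort_const (hv.integrable one_le_two) G₀ k] at key
  simp_rw [toEuclideanCLM_map_ofReal_apply, Finset.mul_sum] at key
  rw [Finset.sum_comm] at key
  rw [rdot_twistFreq, ← key]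
  refine Finset.sum_congr rfl fun b' _ => ?_
  rw [ofReal_vecMul_intCast_apply, Finset.sum_mul]
  exact Finset.sum_congr rfl fun a _ => by ring

omit [DecidableEq d] in
/-- The twisted frequency splits as `G₀ᵀk = k + (G₀ − 1)ᵀk` coordinatewise. [cite: ArmstrongVicol2025, §4.1 (PDF p. 34)] -/
theorem twistFreq_apply_eq_add_sum_sub [DecidableEq d] (G₀ : Matrix d d ℝ) (k : d → ℤ) (b' : d) :
    twistFreq G₀ k b' = (k b' : ℝ) + ∑ a, (k a : ℝ) * (G₀ a b' - (1 : Matrix d d ℝ) a b') := by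
  rw [twistFreq_apply]
  have e : ∑ a, (k a : ℝ) * (G₀ a b' - (1 : Matrix d d ℝ) a b') =
      ∑ a, (k a : ℝ) * G₀ a b' - ∑ a, (k a : ℝ) * (1 : Matrix d d ℝ) a b' := by
    rw [← Finset.sum_sub_distrib]
    exact Finset.sum_congr rfl fun a _ => by ring
  rw [e]
  have e2 : ∑ a, (k a : ℝ) * (1 : Matrix d d ℝ) a b' = (k b' : ℝ) := by
    simp [Matrix.one_apply]
  rw [e2]
  ring

omit [DecidableEq d] in
/-- The perturbation `(G₀ − 1)ᵀk` of an entrywise `θ`-small distortion is bounded by `card d · θ · |k|`: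
`Σ_b (Σ_a k_a (G₀ − 1)_{ab})² ≤ (card d · θ)² |k|²` (Cauchy–Schwarz twice). [cite: ArmstrongVicol2025, §4.1 (PDF p. 34)] -/
theorem sum_sq_sum_mul_sub_le [DecidableEq d] (G₀ : Matrix d d ℝ) {θ : ℝ}
    (hG : ∀ a b', |G₀ a b' - (1 : Matrix d d ℝ) a b'| ≤ θ) (k : d → ℤ) :
    ∑ b', (∑ a, (k a : ℝ) * (G₀ a b' - (1 : Matrix d d ℝ) a b')) ^ 2 ≤
      (Fintype.card d * θ) ^ 2 * FunctionSpaces.Torus.freqNormSq k := by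
  have hrow : ∀ b', (∑ a, (k a : ℝ) * (G₀ a b' - (1 : Matrix d d ℝ) a b')) ^ 2 ≤
      Fintype.card d * θ ^ 2 * FunctionSpaces.Torus.freqNormSq k := by
    intro b'
    have hcs : (∑ a, (k a : ℝ) * (G₀ a b' - (1 : Matrix d d ℝ) a b')) ^ 2 ≤
        (∑ a, (k a : ℝ) ^ 2) * ∑ a, (G₀ a b' - (1 : Matrix d d ℝ) a b') ^ 2 :=
      Finset.sum_mul_sq_le_sq_mul_sq _ _ _
    have h2 : ∑ a, (G₀ a b' - (1 : Matrix d d ℝ) a b') ^ 2 ≤ ∑ _a : d, θ ^ 2 :=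
      Finset.sum_le_sum fun a _ => by
        rw [← sq_abs]
        exact pow_le_pow_left₀ (abs_nonneg _) (hG a b') 2
    rw [Finset.sum_const, Finset.card_univ, nsmul_eq_mul] at h2
    have hN0 := FunctionSpaces.Torus.freqNormSq_nonneg k
    rw [FunctionSpaces.Torus.freqNormSq] at hN0 ⊢
    calc (∑ a, (k a : ℝ) * (G₀ a b' - (1 : Matrix d d ℝ) a b')) ^ 2
        ≤ (∑ a, (k a : ℝ) ^ 2) * ∑ a, (G₀ a b' - (1 : Matrix d d ℝ) a b') ^ 2 := hcs
      _ ≤ (∑ a, (k a : ℝ) ^ 2) * (Fintype.card d * θ ^ 2) := mul_le_mul_of_nonneg_left h2 hN0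
      _ = Fintype.card d * θ ^ 2 * ∑ a, (k a : ℝ) ^ 2 := by ring
  calc ∑ b', (∑ a, (k a : ℝ) * (G₀ a b' - (1 : Matrix d d ℝ) a b')) ^ 2
      ≤ ∑ _b' : d, Fintype.card d * θ ^ 2 * FunctionSpaces.Torus.freqNormSq k := Finset.sum_le_sum fun b' _ => hrow b'
    _ = (Fintype.card d * θ) ^ 2 * FunctionSpaces.Torus.freqNormSq k := by
        rw [Finset.sum_const, Finset.card_univ, nsmul_eq_mul]
        ring

omit [DecidableEq d] in
/-- **Lower frame constant of an entrywise-small distortion.** If `|G₀ − 1| ≤ θ` entrywise and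
`card d · θ ≤ 1`, then for every integer mode `k`, `(1 − card d·θ)² |k|² ≤ |G₀ᵀk|²`
(`|G₀ᵀk| ≥ |k| − |(G₀ − 1)ᵀk| ≥ (1 − card d·θ)|k|`): the twisted dissipation rates are comparable to the
flat ones, uniformly in `k`. [cite: ArmstrongVicol2025, §4.1 (PDF p. 34)] -/
theorem sq_one_sub_mul_freqNormSq_le_sum_twistFreq_sq [DecidableEq d] (G₀ : Matrix d d ℝ) {θ : ℝ} (hθ : 0 ≤ θ)
    (hdθ : Fintype.card d * θ ≤ 1) (hG : ∀ a b', |G₀ a b' - (1 : Matrix d d ℝ) a b'| ≤ θ) (k : d → ℤ) :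
    (1 - Fintype.card d * θ) ^ 2 * FunctionSpaces.Torus.freqNormSq k ≤ ∑ a, twistFreq G₀ k a ^ 2 := by
  -- the three vectors `K`, `R = (G₀ − 1)ᵀk`, `Q = G₀ᵀk = K + R` of `ℝ^d`
  set K : EuclideanSpace ℝ d := WithLp.toLp 2 fun b' => (k b' : ℝ) with hK
  set R : EuclideanSpace ℝ d := WithLp.toLp 2 fun b' => ∑ a, (k a : ℝ) * (G₀ a b' - (1 : Matrix d d ℝ) a b') with hR
  set Q : EuclideanSpace ℝ d := WithLp.toLp 2 fun b' => twistFreq G₀ k b' with hQ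
  have hQKR : Q = K + R := by
    ext b'
    simp only [hQ, hK, hR, PiLp.toLp_apply, PiLp.add_apply]
    exact twistFreq_apply_eq_add_sum_sub G₀ k b'
  have hKn : ‖K‖ ^ 2 = FunctionSpaces.Torus.freqNormSq k := by
    rw [EuclideanSpace.norm_sq_eq, FunctionSpaces.Torus.freqNormSq]
    exact Finset.sum_congr rfl fun b' _ => by rw [hK, PiLp.toLp_apply, Real.norm_eq_abs, sq_abs]
  have hQn : ‖Q‖ ^ 2 = ∑ a, twistFreq G₀ k a ^ 2 := by
    rw [EuclideanSpace.norm_sq_eq]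
    exact Finset.sum_congr rfl fun b' _ => by rw [hQ, PiLp.toLp_apply, Real.norm_eq_abs, sq_abs]
  have hRn : ‖R‖ ^ 2 ≤ (Fintype.card d * θ) ^ 2 * ‖K‖ ^ 2 := by
    rw [hKn, EuclideanSpace.norm_sq_eq]
    have e : ∑ b', ‖R b'‖ ^ 2 = ∑ b', (∑ a, (k a : ℝ) * (G₀ a b' - (1 : Matrix d d ℝ) a b')) ^ 2 :=
      Finset.sum_congr rfl fun b' _ => by rw [hR, PiLp.toLp_apply, Real.norm_eq_abs, sq_abs]
    rw [e]
    exact sum_sq_sum_mul_sub_le G₀ hG k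
  have hdθ0 : 0 ≤ Fintype.card d * θ := by positivity
  have hRle : ‖R‖ ≤ Fintype.card d * θ * ‖K‖ := by
    have h1 : ‖R‖ ^ 2 ≤ (Fintype.card d * θ * ‖K‖) ^ 2 := by rw [mul_pow]; exact hRn
    exact (pow_le_pow_iff_left₀ (norm_nonneg _) (by positivity) two_ne_zero).1 h1
  have hlow : (1 - Fintype.card d * θ) * ‖K‖ ≤ ‖Q‖ := by
    have h1 : ‖K‖ - ‖R‖ ≤ ‖Q‖ := by
      rw [hQKR]
      have := norm_sub_norm_le K (K + R)
      rw [show K - (K + R) = -R by abel, norm_neg] at this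
      linarith
    calc (1 - Fintype.card d * θ) * ‖K‖ = ‖K‖ - Fintype.card d * θ * ‖K‖ := by ring
      _ ≤ ‖K‖ - ‖R‖ := by linarith
      _ ≤ ‖Q‖ := h1
  have h0 : 0 ≤ (1 - Fintype.card d * θ) * ‖K‖ := mul_nonneg (by linarith) (norm_nonneg _)
  have hsq := pow_le_pow_left₀ h0 hlow 2
  rw [mul_pow, hKn, hQn] at hsq
  exact hsq

omit [DecidableEq d] in
/-- **Upper frame constant of an entrywise-small distortion**: `|G₀ − 1| ≤ θ` entrywise gives
`|G₀ᵀk|² ≤ (1 + card d·θ)² |k|²`. [cite: ArmstrongVicol2025, §4.1 (PDF p. 34)] -/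
theorem sum_twistFreq_sq_le_sq_one_add_mul_freqNormSq [DecidableEq d] (G₀ : Matrix d d ℝ) {θ : ℝ} (hθ : 0 ≤ θ)
    (hG : ∀ a b', |G₀ a b' - (1 : Matrix d d ℝ) a b'| ≤ θ) (k : d → ℤ) :
    ∑ a, twistFreq G₀ k a ^ 2 ≤ (1 + Fintype.card d * θ) ^ 2 * FunctionSpaces.Torus.freqNormSq k := by
  set K : EuclideanSpace ℝ d := WithLp.toLp 2 fun b' => (k b' : ℝ) with hK
  set R : EuclideanSpace ℝ d := WithLp.toLp 2 fun b' => ∑ a, (k a : ℝ) * (G₀ a b' - (1 : Matrix d d ℝ) a b') with hR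
  set Q : EuclideanSpace ℝ d := WithLp.toLp 2 fun b' => twistFreq G₀ k b' with hQ
  have hQKR : Q = K + R := by
    ext b'
    simp only [hQ, hK, hR, PiLp.toLp_apply, PiLp.add_apply]
    exact twistFreq_apply_eq_add_sum_sub G₀ k b'
  have hKn : ‖K‖ ^ 2 = FunctionSpaces.Torus.freqNormSq k := by
    rw [EuclideanSpace.norm_sq_eq, FunctionSpaces.Torus.freqNormSq]
    exact Finset.sum_congr rfl fun b' _ => by rw [hK, PiLp.toLp_apply, Real.norm_eq_abs, sq_abs]
  have hQn : ‖Q‖ ^ 2 = ∑ a, twistFreq G₀ k a ^ 2 := by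
    rw [EuclideanSpace.norm_sq_eq]
    exact Finset.sum_congr rfl fun b' _ => by rw [hQ, PiLp.toLp_apply, Real.norm_eq_abs, sq_abs]
  have hRn : ‖R‖ ^ 2 ≤ (Fintype.card d * θ) ^ 2 * ‖K‖ ^ 2 := by
    rw [hKn, EuclideanSpace.norm_sq_eq]
    have e : ∑ b', ‖R b'‖ ^ 2 = ∑ b', (∑ a, (k a : ℝ) * (G₀ a b' - (1 : Matrix d d ℝ) a b')) ^ 2 :=
      Finset.sum_congr rfl fun b' _ => by rw [hR, PiLp.toLp_apply, Real.norm_eq_abs, sq_abs]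
    rw [e]
    exact sum_sq_sum_mul_sub_le G₀ hG k
  have hRle : ‖R‖ ≤ Fintype.card d * θ * ‖K‖ := by
    have h1 : ‖R‖ ^ 2 ≤ (Fintype.card d * θ * ‖K‖) ^ 2 := by rw [mul_pow]; exact hRn
    exact (pow_le_pow_iff_left₀ (norm_nonneg _) (by positivity) two_ne_zero).1 h1
  have hup : ‖Q‖ ≤ (1 + Fintype.card d * θ) * ‖K‖ := by
    rw [hQKR]
    calc ‖K + R‖ ≤ ‖K‖ + ‖R‖ := norm_add_le _ _
      _ ≤ ‖K‖ + Fintype.card d * θ * ‖K‖ := by linarith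
      _ = (1 + Fintype.card d * θ) * ‖K‖ := by ring
  have hsq := pow_le_pow_left₀ (norm_nonneg _) hup 2
  rw [mul_pow, hKn, hQn] at hsq
  exact hsq

end Fibre

/-! ## §1a Scalar lemmas (verbatim from the flat file) -/

section Scalar

/-- Product rule for an a.e. primitive with datum: `U(t) = c + ∫_{(0,t]} F` a.e. with `F ∈ L¹(0,T)`
gives `U(t)² = c² + 2 ∫_{(0,t]} F U` a.e. [folklore] -/
private theorem ae_sq_eq_of_ae_eq_add_setIntegral_cf {T c : ℝ} {U F : ℝ → ℝ} (hF : IntegrableOn F (Ioo 0 T) volume)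
    (hU : ∀ᵐ t ∂(volume.restrict (Ioo 0 T)), U t = c + ∫ τ in Ioc 0 t, F τ) :
    ∀ᵐ t ∂(volume.restrict (Ioo 0 T)), U t ^ 2 = c ^ 2 + 2 * ∫ τ in Ioc 0 t, F τ * U τ := by
  have hU' : ∀ᵐ τ ∂(volume : Measure ℝ), τ ∈ Ioo 0 T → U τ = c + ∫ r in Ioc 0 τ, F r :=
    (ae_restrict_iff' measurableSet_Ioo).1 hU
  filter_upwards [hU, ae_restrict_mem measurableSet_Ioo] with t ht htT
  have hsub : Ioc 0 t ⊆ Ioo 0 T := Ioc_subset_Ioo_right htT.2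
  rw [ht, sq_const_add_setIntegral_eq (hF.mono_set hsub)]
  congr 1
  congr 1
  refine setIntegral_congr_ae measurableSet_Ioc ?_
  filter_upwards [hU'] with τ hτ hτI
  rw [hτ (hsub hτI)]

/-- `Re a · Re h + Im a · Im h = Re (conj a · h)`. [folklore] -/
private theorem re_mul_re_add_im_mul_im_cf (a h : ℂ) : a.re * h.re + a.im * h.im = (conj a * h).re := by
  simp [Complex.mul_re, Complex.conj_re, Complex.conj_im]

/-- `‖a‖² = (Re a)² + (Im a)²`. [folklore] -/
private theorem norm_sq_eq_re_sq_add_im_sq_cf (a : ℂ) : ‖a‖ ^ 2 = a.re ^ 2 + a.im ^ 2 := by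
  rw [Complex.sq_norm, Complex.normSq_apply]
  ring

/-- `∫ ‖f‖ ≤ C` from `‖f‖_{L²} ≤ C` on the probability space `T^d`. [folklore] -/
private theorem integral_norm_le_of_eLpNorm_two_le_cf {f : UnitAddTorus d → EuclideanSpace ℝ d}
    (hf : MemLp f 2 volume) {C : ℝ≥0} (h : eLpNorm f 2 volume ≤ C) : ∫ x, ‖f x‖ ≤ C := by
  have h1 : ENNReal.ofReal (∫ x, ‖f x‖) = eLpNorm f 1 volume := by
    rw [eLpNorm_one_eq_lintegral_enorm, ← ofReal_integral_norm_eq_lintegral_enorm (hf.integrable one_le_two)]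
  have h2 : ENNReal.ofReal (∫ x, ‖f x‖) ≤ C :=
    h1.le.trans ((eLpNorm_le_eLpNorm_of_exponent_le (by norm_num) hf.1).trans h)
  have := (ENNReal.ofReal_le_iff_le_toReal ENNReal.coe_ne_top).1 h2
  simpa using this

/-- `‖𝓕(complexify ∘ f)(k)‖ ≤ ∫ ‖f‖` for integrable `f`. [folklore] -/
private theorem norm_mFourierCoeff_complexify_le_cf {f : UnitAddTorus d → EuclideanSpace ℝ d}
    (hf : Integrable f volume) (k : d → ℤ) :
    ‖mFourierCoeff (FunctionSpaces.EuclideanSpace.complexify ∘ f) k‖ ≤ ∫ x, ‖f x‖ := by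
  rw [FunctionSpaces.Torus.mFourierCoeff_eq_integral_volume]
  have hint : Integrable (fun x => mFourier (-k) x • (FunctionSpaces.EuclideanSpace.complexify ∘ f) x) volume :=
    FunctionSpaces.Torus.integrable_mFourier_smul' (FunctionSpaces.Torus.integrable_complexify_comp hf) k
  refine (norm_integral_le_integral_norm _).trans (integral_mono hint.norm hf.norm fun x => ?_)
  dsimp only
  rw [norm_smul, Function.comp_apply, FunctionSpaces.EuclideanSpace.norm_complexify]
  exact mul_le_of_le_one_left (norm_nonneg _) (((mFourier (-k)).norm_coe_le_norm x).trans_eq mFourier_norm)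

/-- `(a + |A| b)² ≤ (1 + A²)(a² + b²)`. [folklore] -/
private theorem sq_add_abs_mul_le_cf (A a b : ℝ) : (a + |A| * b) ^ 2 ≤ (1 + A ^ 2) * (a ^ 2 + b ^ 2) := by
  nlinarith [sq_nonneg (|A| * a - b), sq_abs A]

/-- `‖B(z)‖² ≤ 4π²|k|² (1 + A²) ‖z‖² ∑ⱼ (‖Fⱼ‖² + ‖Gⱼ‖²)` (Cauchy–Schwarz). [folklore] -/
private theorem norm_sq_modeRHS_le_cf (A : ℝ) (k : d → ℤ) (z : EuclideanSpace ℂ d) (F G : d → EuclideanSpace ℂ d) :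
    ‖(∑ j, (2 * Real.pi * I * (k j)) * ⟪F j, z⟫_ℂ) + (A : ℂ) * ∑ j, (2 * Real.pi * I * (k j)) * ⟪G j, z⟫_ℂ‖ ^ 2 ≤
      4 * Real.pi ^ 2 * FunctionSpaces.Torus.freqNormSq k * ((1 + A ^ 2) * ‖z‖ ^ 2) *
        ∑ j, (‖F j‖ ^ 2 + ‖G j‖ ^ 2) := by
  have hkj : ∀ j, ‖(2 * Real.pi * I * (k j) : ℂ)‖ = 2 * Real.pi * |(k j : ℝ)| := by
    intro j
    rw [norm_mul, norm_mul, norm_mul, Complex.norm_I, mul_one, Complex.norm_intCast, Complex.norm_real,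
      Real.norm_eq_abs, abs_of_pos Real.pi_pos, ← Int.cast_abs, Int.cast_abs]
    norm_num
  have h1 : ‖(∑ j, (2 * Real.pi * I * (k j)) * ⟪F j, z⟫_ℂ) + (A : ℂ) * ∑ j, (2 * Real.pi * I * (k j)) * ⟪G j, z⟫_ℂ‖ ≤
      ∑ j, (2 * Real.pi * |(k j : ℝ)|) * (‖z‖ * (‖F j‖ + |A| * ‖G j‖)) := by
    rw [Finset.mul_sum, ← Finset.sum_add_distrib]
    refine (norm_sum_le _ _).trans (Finset.sum_le_sum fun j _ => ?_)
    have a1 : ‖(2 * Real.pi * I * (k j)) * ⟪F j, z⟫_ℂ‖ ≤ 2 * Real.pi * |(k j : ℝ)| * (‖F j‖ * ‖z‖) := by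
      rw [norm_mul, hkj]
      exact mul_le_mul_of_nonneg_left (norm_inner_le_norm _ _) (by positivity)
    have a2 : ‖(A : ℂ) * ((2 * Real.pi * I * (k j)) * ⟪G j, z⟫_ℂ)‖ ≤
        |A| * (2 * Real.pi * |(k j : ℝ)| * (‖G j‖ * ‖z‖)) := by
      rw [norm_mul, norm_mul, hkj, Complex.norm_real, Real.norm_eq_abs]
      exact mul_le_mul_of_nonneg_left (mul_le_mul_of_nonneg_left (norm_inner_le_norm _ _) (by positivity))
        (abs_nonneg _)
    calc ‖(2 * Real.pi * I * (k j)) * ⟪F j, z⟫_ℂ + (A : ℂ) * ((2 * Real.pi * I * (k j)) * ⟪G j, z⟫_ℂ)‖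
        ≤ ‖(2 * Real.pi * I * (k j)) * ⟪F j, z⟫_ℂ‖ + ‖(A : ℂ) * ((2 * Real.pi * I * (k j)) * ⟪G j, z⟫_ℂ)‖ :=
          norm_add_le _ _
      _ ≤ 2 * Real.pi * |(k j : ℝ)| * (‖F j‖ * ‖z‖) + |A| * (2 * Real.pi * |(k j : ℝ)| * (‖G j‖ * ‖z‖)) :=
          add_le_add a1 a2
      _ = 2 * Real.pi * |(k j : ℝ)| * (‖z‖ * (‖F j‖ + |A| * ‖G j‖)) := by ring
  have h2 : (∑ j, (2 * Real.pi * |(k j : ℝ)|) * (‖z‖ * (‖F j‖ + |A| * ‖G j‖))) ^ 2 ≤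
      (∑ j, (2 * Real.pi * |(k j : ℝ)|) ^ 2) * ∑ j, (‖z‖ * (‖F j‖ + |A| * ‖G j‖)) ^ 2 :=
    Finset.sum_mul_sq_le_sq_mul_sq _ _ _
  have h3 : ∑ j, (2 * Real.pi * |(k j : ℝ)|) ^ 2 = 4 * Real.pi ^ 2 * FunctionSpaces.Torus.freqNormSq k := by
    rw [FunctionSpaces.Torus.freqNormSq, Finset.mul_sum]
    exact Finset.sum_congr rfl fun j _ => by rw [mul_pow, sq_abs]; ring
  have h4 : ∑ j, (‖z‖ * (‖F j‖ + |A| * ‖G j‖)) ^ 2 ≤ (1 + A ^ 2) * ‖z‖ ^ 2 * ∑ j, (‖F j‖ ^ 2 + ‖G j‖ ^ 2) := by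
    rw [Finset.mul_sum]
    refine Finset.sum_le_sum fun j _ => ?_
    rw [mul_pow]
    calc ‖z‖ ^ 2 * (‖F j‖ + |A| * ‖G j‖) ^ 2 ≤ ‖z‖ ^ 2 * ((1 + A ^ 2) * (‖F j‖ ^ 2 + ‖G j‖ ^ 2)) :=
          mul_le_mul_of_nonneg_left (sq_add_abs_mul_le_cf A _ _) (sq_nonneg _)
      _ = (1 + A ^ 2) * ‖z‖ ^ 2 * (‖F j‖ ^ 2 + ‖G j‖ ^ 2) := by ring
  have hN0 := FunctionSpaces.Torus.freqNormSq_nonneg k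
  calc ‖(∑ j, (2 * Real.pi * I * (k j)) * ⟪F j, z⟫_ℂ) + (A : ℂ) * ∑ j, (2 * Real.pi * I * (k j)) * ⟪G j, z⟫_ℂ‖ ^ 2
      ≤ (∑ j, (2 * Real.pi * |(k j : ℝ)|) * (‖z‖ * (‖F j‖ + |A| * ‖G j‖))) ^ 2 :=
        pow_le_pow_left₀ (norm_nonneg _) h1 2
    _ ≤ (∑ j, (2 * Real.pi * |(k j : ℝ)|) ^ 2) * ∑ j, (‖z‖ * (‖F j‖ + |A| * ‖G j‖)) ^ 2 := h2
    _ ≤ (4 * Real.pi ^ 2 * FunctionSpaces.Torus.freqNormSq k) *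
          ((1 + A ^ 2) * ‖z‖ ^ 2 * ∑ j, (‖F j‖ ^ 2 + ‖G j‖ ^ 2)) := by
        rw [h3]
        exact mul_le_mul_of_nonneg_left h4 (by positivity)
    _ = 4 * Real.pi ^ 2 * FunctionSpaces.Torus.freqNormSq k * ((1 + A ^ 2) * ‖z‖ ^ 2) *
          ∑ j, (‖F j‖ ^ 2 + ‖G j‖ ^ 2) := by ring

/-- Young's inequality for the mode right-hand side tested against the mode itself (`lo > 0`):
`2 Re B(X) ≤ 4π² lo |k|² ‖X‖² + ((1 + A²)/lo) ∑ⱼ (‖Fⱼ‖² + ‖Gⱼ‖²)`. [folklore] -/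
private theorem two_mul_re_modeRHS_le_cf {lo : ℝ} (hlo : 0 < lo) (A : ℝ) (k : d → ℤ) (X : EuclideanSpace ℂ d)
    (F G : d → EuclideanSpace ℂ d) :
    2 * ((∑ j, (2 * Real.pi * I * (k j)) * ⟪F j, X⟫_ℂ) + (A : ℂ) * ∑ j, (2 * Real.pi * I * (k j)) * ⟪G j, X⟫_ℂ).re ≤
      4 * Real.pi ^ 2 * lo * FunctionSpaces.Torus.freqNormSq k * ‖X‖ ^ 2 +
        ((1 + A ^ 2) / lo) * ∑ j, (‖F j‖ ^ 2 + ‖G j‖ ^ 2) := by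
  set B : ℂ := (∑ j, (2 * Real.pi * I * (k j)) * ⟪F j, X⟫_ℂ) + (A : ℂ) * ∑ j, (2 * Real.pi * I * (k j)) * ⟪G j, X⟫_ℂ
    with hB
  set a : ℝ := 4 * Real.pi ^ 2 * lo * FunctionSpaces.Torus.freqNormSq k * ‖X‖ ^ 2 with ha
  set c : ℝ := ((1 + A ^ 2) / lo) * ∑ j, (‖F j‖ ^ 2 + ‖G j‖ ^ 2) with hc
  have hN0 := FunctionSpaces.Torus.freqNormSq_nonneg k
  have hγ0 : 0 ≤ ∑ j, (‖F j‖ ^ 2 + ‖G j‖ ^ 2) := Finset.sum_nonneg fun j _ => by positivity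
  have ha0 : 0 ≤ a := by positivity
  have hc0 : 0 ≤ c := by positivity
  have hsq : ‖B‖ ^ 2 ≤ a * c := by
    refine (norm_sq_modeRHS_le_cf A k X F G).trans (le_of_eq ?_)
    rw [ha, hc]
    field_simp
  have h2 : 2 * ‖B‖ ≤ a + c := by
    have h4 : (2 * ‖B‖) ^ 2 ≤ (a + c) ^ 2 := by nlinarith [hsq, sq_nonneg (a - c), norm_nonneg B]
    exact (pow_le_pow_iff_left₀ (by positivity) (by positivity) two_ne_zero).1 h4
  calc 2 * B.re ≤ 2 * ‖B‖ := by
        have := Complex.re_le_norm B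
        linarith
    _ ≤ a + c := h2

end Scalar

/-! ## §1b Linear algebra of the mode right-hand side (verbatim from the flat file) -/

section SymbolAlgebra

/-- Pulling a scalar out of a transport sum. [folklore] -/
private theorem modeRHS_sumpull_cf (k : d → ℤ) (μ : ℂ) (f : d → ℂ) :
    ∑ j, (2 * Real.pi * I * (k j)) * (μ * f j) = μ * ∑ j, (2 * Real.pi * I * (k j)) * f j := by
  rw [Finset.mul_sum]; exact Finset.sum_congr rfl fun j _ => by ring

/-- **The mode right-hand side `H(z) = −4π² ⟪X, T_𝔹(k) z⟫ + B(z)` is `ℂ`-linear in `z`**: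
`H(Σᵢ μᵢ eᵢ) = Σᵢ μᵢ H(eᵢ)` (any tensor `𝔹`). [folklore] -/
private theorem modeRHS_sum_smul_cf {ι : Type*} (s : Finset ι) (𝔹 : Visc4 d) (k : d → ℤ) (A : ℝ)
    (X : EuclideanSpace ℂ d) (F G : d → EuclideanSpace ℂ d) (μ : ι → ℂ) (e : ι → EuclideanSpace ℂ d) :
    (-(4 * Real.pi ^ 2 : ℝ) : ℂ) * ⟪X, symbT 𝔹 k (∑ i ∈ s, μ i • e i)⟫_ℂ +
        ((∑ j, (2 * Real.pi * I * (k j)) * ⟪F j, ∑ i ∈ s, μ i • e i⟫_ℂ) +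
          (A : ℂ) * ∑ j, (2 * Real.pi * I * (k j)) * ⟪G j, ∑ i ∈ s, μ i • e i⟫_ℂ) =
      ∑ i ∈ s, μ i * ((-(4 * Real.pi ^ 2 : ℝ) : ℂ) * ⟪X, symbT 𝔹 k (e i)⟫_ℂ +
        ((∑ j, (2 * Real.pi * I * (k j)) * ⟪F j, e i⟫_ℂ) + (A : ℂ) * ∑ j, (2 * Real.pi * I * (k j)) * ⟪G j, e i⟫_ℂ)) := by
  classical
  induction s using Finset.induction_on with
  | empty => simp
  | insert a s ha ih =>
    rw [Finset.sum_insert ha, Finset.sum_insert ha, ← ih]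
    simp only [symbT_add, symbT_smul, inner_add_right, inner_smul_right, mul_add, Finset.sum_add_distrib,
      modeRHS_sumpull_cf]
    ring

/-- Parseval in a subspace: for `X ∈ S` and an orthonormal basis `(eᵢ)` of `S`,
`Σᵢ |⟪X, eᵢ⟫|² = ‖X‖²`. [folklore] -/
private theorem sum_sq_norm_inner_onb_cf {ι : Type*} [Fintype ι] {S : Submodule ℂ (EuclideanSpace ℂ d)}
    (b : OrthonormalBasis ι ℂ S) {X : EuclideanSpace ℂ d} (hX : X ∈ S) :
    ∑ i, ‖⟪X, (b i : EuclideanSpace ℂ d)⟫_ℂ‖ ^ 2 = ‖X‖ ^ 2 := by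
  have h1 : ‖(⟨X, hX⟩ : S)‖ ^ 2 = ∑ i, ‖b.repr ⟨X, hX⟩ i‖ ^ 2 := by
    rw [← b.repr.norm_map, EuclideanSpace.norm_sq_eq]
  have h2 : ∀ i, b.repr ⟨X, hX⟩ i = ⟪(b i : EuclideanSpace ℂ d), X⟫_ℂ := fun i => by
    rw [OrthonormalBasis.repr_apply_apply, Submodule.coe_inner]
  rw [show ‖X‖ = ‖(⟨X, hX⟩ : S)‖ from rfl, h1]
  refine Finset.sum_congr rfl fun i _ => ?_
  rw [h2, norm_inner_symm]

/-- Expansion in a subspace with conjugated coefficients: `Σᵢ conj⟪X, eᵢ⟫ eᵢ = X` for `X ∈ S`.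
[folklore] -/
private theorem sum_conj_inner_smul_onb_cf {ι : Type*} [Fintype ι] {S : Submodule ℂ (EuclideanSpace ℂ d)}
    (b : OrthonormalBasis ι ℂ S) {X : EuclideanSpace ℂ d} (hX : X ∈ S) :
    ∑ i, conj ⟪X, (b i : EuclideanSpace ℂ d)⟫_ℂ • (b i : EuclideanSpace ℂ d) = X := by
  have h := b.sum_repr' ⟨X, hX⟩
  have h' := congrArg (fun v : S => (v : EuclideanSpace ℂ d)) h
  simp only [Submodule.coe_sum, Submodule.coe_smul, Submodule.coe_inner] at h'
  simp_rw [inner_conj_symm]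
  exact h'

end SymbolAlgebra

/-! ## §1 The kinematic mode API of the distorted class (any frame `G`) -/

section Kinematic

variable [DecidableEq d]

namespace IsWeakTensorPassiveVectorDistortedOn

variable {A T : ℝ} {𝔸 : Visc4 d} {b w : ℝ → UnitAddTorus d → EuclideanSpace ℝ d}
  {G : ℝ → UnitAddTorus d → Matrix d d ℝ} {w₀ : UnitAddTorus d → EuclideanSpace ℝ d}

/-- The pairing with a continuous steady field is essentially bounded on `(0,T)`:
`|∫⟪w(τ), Γ⟫| ≤ K` for a.e. `τ` (distorted class, any frame). [cite: DiPernaLions1989, §II.1 (12)–(14)] -/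
theorem exists_ae_abs_integral_inner_le (h : IsWeakTensorPassiveVectorDistortedOn A T 𝔸 b G w₀ w)
    {Γ : UnitAddTorus d → EuclideanSpace ℝ d} (hΓ : Continuous Γ) :
    ∃ K : ℝ, ∀ᵐ τ ∂(volume.restrict (Ioo 0 T)), |∫ x, ⟪w τ x, Γ x⟫_ℝ| ≤ K := by
  obtain ⟨M, hM⟩ := (isCompact_univ.image hΓ).isBounded.exists_norm_le
  have hM' : ∀ x, ‖Γ x‖ ≤ M := fun x => hM _ ⟨x, mem_univ _, rfl⟩
  obtain ⟨C₁, hC₁⟩ := h.exists_eLpNorm_le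
  have h0 : 0 ≤ M := (norm_nonneg _).trans (hM' 0)
  refine ⟨M * C₁, ?_⟩
  filter_upwards [hC₁, h.ae_memLp_two] with τ hτ hm
  have hI : Integrable (w τ) volume := hm.integrable one_le_two
  calc |∫ x, ⟪w τ x, Γ x⟫_ℝ| ≤ ∫ x, M * ‖w τ x‖ := by
        rw [← Real.norm_eq_abs]
        refine norm_integral_le_of_norm_le (hI.norm.const_mul M) (Eventually.of_forall fun x => ?_)
        rw [mul_comm]
        exact (norm_inner_le_norm _ _).trans (mul_le_mul_of_nonneg_left (hM' x) (norm_nonneg _))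
    _ = M * ∫ x, ‖w τ x‖ := integral_const_mul _ _
    _ ≤ M * C₁ := mul_le_mul_of_nonneg_left (integral_norm_le_of_eLpNorm_two_le_cf hm hτ) h0

/-- The Fourier modes of a distorted weak solution are essentially bounded: `‖ŵ(τ)(k)‖ ≤ K` for a.e.
`τ` (`‖ŵ(τ)(k)‖ ≤ ‖w(τ)‖_{L¹} ≤ ‖w(τ)‖_{L²}`; any frame).
[cite: RobinsonRodrigoSadowski2016, §4.2 (Galerkin energy estimate)] -/
theorem exists_ae_norm_mFourierCoeff_le (h : IsWeakTensorPassiveVectorDistortedOn A T 𝔸 b G w₀ w) (k : d → ℤ) :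
    ∃ K : ℝ, 0 ≤ K ∧ ∀ᵐ τ ∂(volume.restrict (Ioo 0 T)),
      ‖mFourierCoeff (FunctionSpaces.EuclideanSpace.complexify ∘ w τ) k‖ ≤ K := by
  obtain ⟨C₁, hC₁⟩ := h.exists_eLpNorm_le
  refine ⟨C₁, C₁.2, ?_⟩
  filter_upwards [hC₁, h.ae_memLp_two] with τ hτ hm
  exact (norm_mFourierCoeff_complexify_le_cf (hm.integrable one_le_two) k).trans
    (integral_norm_le_of_eLpNorm_two_le_cf hm hτ)

/-- The mode pairings are essentially bounded: `|⟪ŵ(τ)(k), z⟫| ≤ K` for a.e. `τ ∈ (0,T)` (any frame).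
[cite: DiPernaLions1989, §II.1 (12)–(14)] -/
theorem exists_ae_norm_inner_mFourierCoeff_le (h : IsWeakTensorPassiveVectorDistortedOn A T 𝔸 b G w₀ w)
    (k : d → ℤ) (z : EuclideanSpace ℂ d) :
    ∃ K : ℝ, ∀ᵐ τ ∂(volume.restrict (Ioo 0 T)),
      ‖⟪mFourierCoeff (FunctionSpaces.EuclideanSpace.complexify ∘ w τ) k, z⟫_ℂ‖ ≤ K := by
  obtain ⟨C₁, _, hC₁⟩ := h.exists_ae_norm_mFourierCoeff_le k
  refine ⟨C₁ * ‖z‖, ?_⟩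
  filter_upwards [hC₁] with τ hτ
  exact (norm_inner_le_norm _ _).trans (mul_le_mul_of_nonneg_right hτ (norm_nonneg _))

/-- Integrability on `(0,T)` of `conj α · H` for the mode pairing `α(τ) = ⟪ŵ(τ)(k), z⟫` (essentially
bounded) and any `H ∈ L¹(0,T)` (any frame). [cite: DiPernaLions1989, §II.1 (12)–(14)] -/
theorem integrableOn_conj_inner_mul (h : IsWeakTensorPassiveVectorDistortedOn A T 𝔸 b G w₀ w) (k : d → ℤ)
    (z : EuclideanSpace ℂ d) {H : ℝ → ℂ} (hH : IntegrableOn H (Ioo 0 T) volume) :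
    IntegrableOn (fun τ => conj ⟪mFourierCoeff (FunctionSpaces.EuclideanSpace.complexify ∘ w τ) k, z⟫_ℂ * H τ)
      (Ioo 0 T) volume := by
  obtain ⟨K, hK⟩ := h.exists_ae_norm_inner_mFourierCoeff_le k z
  have hαm : AEStronglyMeasurable
      (fun τ => conj ⟪mFourierCoeff (FunctionSpaces.EuclideanSpace.complexify ∘ w τ) k, z⟫_ℂ)
      (volume.restrict (Ioo 0 T)) :=
    (continuous_conj.comp_aestronglyMeasurable ((h.integrableOn_mFourierCoeff k).inner_const z).aestronglyMeasurable)
  refine Integrable.bdd_mul (c := K) hH hαm ?_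
  filter_upwards [hK] with τ hτ
  rwa [Complex.norm_conj]

/-- The squared mode pairings `τ ↦ |⟪ŵ(τ)(k), z⟫|²` are integrable on `(0,T)` (essentially bounded; any
frame). [cite: RobinsonRodrigoSadowski2016, §4.2 (Galerkin energy estimate)] -/
theorem integrableOn_norm_sq_inner (h : IsWeakTensorPassiveVectorDistortedOn A T 𝔸 b G w₀ w) (k : d → ℤ)
    (z : EuclideanSpace ℂ d) :
    IntegrableOn (fun τ => ‖⟪mFourierCoeff (FunctionSpaces.EuclideanSpace.complexify ∘ w τ) k, z⟫_ℂ‖ ^ 2)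
      (Ioo 0 T) volume := by
  obtain ⟨K, hK⟩ := h.exists_ae_norm_inner_mFourierCoeff_le k z
  have hm : AEStronglyMeasurable
      (fun τ => ‖⟪mFourierCoeff (FunctionSpaces.EuclideanSpace.complexify ∘ w τ) k, z⟫_ℂ‖ ^ 2)
      (volume.restrict (Ioo 0 T)) :=
    (((h.integrableOn_mFourierCoeff k).inner_const z).aestronglyMeasurable.norm.pow 2)
  refine IntegrableOn.of_bound measure_Ioo_lt_top hm (K ^ 2) ?_
  filter_upwards [hK] with τ hτ
  rw [Real.norm_eq_abs, abs_of_nonneg (sq_nonneg _)]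
  exact pow_le_pow_left₀ (norm_nonneg _) hτ 2

/-- The squared modes `τ ↦ ‖ŵ(τ)(k)‖²` are integrable on `(0,T)` (essentially bounded; any frame).
[cite: RobinsonRodrigoSadowski2016, §4.2 (Galerkin energy estimate)] -/
theorem integrableOn_norm_sq_mFourierCoeff (h : IsWeakTensorPassiveVectorDistortedOn A T 𝔸 b G w₀ w) (k : d → ℤ) :
    IntegrableOn (fun τ => ‖mFourierCoeff (FunctionSpaces.EuclideanSpace.complexify ∘ w τ) k‖ ^ 2)
      (Ioo 0 T) volume := by
  obtain ⟨K, _, hK⟩ := h.exists_ae_norm_mFourierCoeff_le k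
  have hm : AEStronglyMeasurable
      (fun τ => ‖mFourierCoeff (FunctionSpaces.EuclideanSpace.complexify ∘ w τ) k‖ ^ 2)
      (volume.restrict (Ioo 0 T)) :=
    ((h.integrableOn_mFourierCoeff k).aestronglyMeasurable.norm.pow 2)
  refine IntegrableOn.of_bound measure_Ioo_lt_top hm (K ^ 2) ?_
  filter_upwards [hK] with τ hτ
  rw [Real.norm_eq_abs, abs_of_nonneg (sq_nonneg _)]
  exact pow_le_pow_left₀ (norm_nonneg _) hτ 2

/-- The viscous mode pairing `τ ↦ ⟪ŵ(τ)(k), T_𝔹(k) ŵ(τ)(k)⟫` is integrable on `(0,T)` for ANY tensor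
`𝔹` (essentially bounded mode, bounded symbol; used with `𝔹 = 𝔸^{G₀}`; any frame).
[cite: Frisch1995Turbulence, §9.6.3 eq. (9.57) p. 233] -/
theorem integrableOn_inner_symbT (h : IsWeakTensorPassiveVectorDistortedOn A T 𝔸 b G w₀ w) (𝔹 : Visc4 d)
    (k : d → ℤ) :
    IntegrableOn (fun τ => ⟪mFourierCoeff (FunctionSpaces.EuclideanSpace.complexify ∘ w τ) k,
      symbT 𝔹 k (mFourierCoeff (FunctionSpaces.EuclideanSpace.complexify ∘ w τ) k)⟫_ℂ) (Ioo 0 T) volume := by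
  obtain ⟨K, hK0, hK⟩ := h.exists_ae_norm_mFourierCoeff_le k
  obtain ⟨C, hC0, hC⟩ := exists_norm_symbT_le 𝔹 k
  have hXm : AEStronglyMeasurable (fun τ => mFourierCoeff (FunctionSpaces.EuclideanSpace.complexify ∘ w τ) k)
      (volume.restrict (Ioo 0 T)) := (h.integrableOn_mFourierCoeff k).aestronglyMeasurable
  have hm : AEStronglyMeasurable (fun τ => ⟪mFourierCoeff (FunctionSpaces.EuclideanSpace.complexify ∘ w τ) k,
      symbT 𝔹 k (mFourierCoeff (FunctionSpaces.EuclideanSpace.complexify ∘ w τ) k)⟫_ℂ)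
      (volume.restrict (Ioo 0 T)) :=
    hXm.inner ((continuous_symbT 𝔹 k).comp_aestronglyMeasurable hXm)
  refine IntegrableOn.of_bound measure_Ioo_lt_top hm (K * (C * K)) ?_
  filter_upwards [hK] with τ hτ
  exact (norm_inner_le_norm _ _).trans
    (mul_le_mul hτ ((hC _).trans (mul_le_mul_of_nonneg_left hτ hC0)) (norm_nonneg _) hK0)

/-- Integrability on `(0,T)` of the transport part `τ ↦ B_τ(z)` of the mode right-hand side for a fixed
`z` (any frame). [cite: RobinsonRodrigoSadowski2016, §4.2 (Galerkin energy estimate)] -/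
theorem integrableOn_modeRHS_form (h : IsWeakTensorPassiveVectorDistortedOn A T 𝔸 b G w₀ w) (k : d → ℤ)
    (z : EuclideanSpace ℂ d) :
    IntegrableOn (fun τ =>
      (∑ j, (2 * Real.pi * I * (k j)) *
          ⟪mFourierCoeff (FunctionSpaces.EuclideanSpace.complexify ∘ fun x => b τ x j • w τ x) k, z⟫_ℂ) +
        (A : ℂ) * ∑ j, (2 * Real.pi * I * (k j)) *
          ⟪mFourierCoeff (FunctionSpaces.EuclideanSpace.complexify ∘ fun x => w τ x j • b τ x) k, z⟫_ℂ)
      (Ioo 0 T) volume :=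
  (integrable_finsetSum _ fun j _ => ((h.integrableOn_mFourierCoeff_carrier_smul j k).inner_const z).const_mul _).add
    ((integrable_finsetSum _ fun j _ =>
      ((h.integrableOn_mFourierCoeff_smul_carrier j k).inner_const z).const_mul _).const_mul _)

/-- The transport part of the mode energy integrand, `s ↦ Re B_k(ŵ(s)(k))(s)` tested against the mode
itself, is integrable on `(0,T)` (integrable fluxes times the essentially bounded mode; any frame).
[cite: RobinsonRodrigoSadowski2016, §4.2 (Galerkin energy estimate)] -/
theorem integrableOn_modeRHS_self (h : IsWeakTensorPassiveVectorDistortedOn A T 𝔸 b G w₀ w) (k : d → ℤ) :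
    IntegrableOn (fun s =>
      (∑ j, (2 * Real.pi * I * (k j)) *
          ⟪mFourierCoeff (FunctionSpaces.EuclideanSpace.complexify ∘ fun x => b s x j • w s x) k,
            mFourierCoeff (FunctionSpaces.EuclideanSpace.complexify ∘ w s) k⟫_ℂ) +
        (A : ℂ) * ∑ j, (2 * Real.pi * I * (k j)) *
          ⟪mFourierCoeff (FunctionSpaces.EuclideanSpace.complexify ∘ fun x => w s x j • b s x) k,
            mFourierCoeff (FunctionSpaces.EuclideanSpace.complexify ∘ w s) k⟫_ℂ) (Ioo 0 T) volume := by
  obtain ⟨C₁, _, hXb⟩ := h.exists_ae_norm_mFourierCoeff_le k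
  have hXm : AEStronglyMeasurable (fun s => mFourierCoeff (FunctionSpaces.EuclideanSpace.complexify ∘ w s) k)
      (volume.restrict (Ioo 0 T)) := (h.integrableOn_mFourierCoeff k).aestronglyMeasurable
  have hFi : ∀ j, IntegrableOn (fun s =>
      mFourierCoeff (FunctionSpaces.EuclideanSpace.complexify ∘ fun x => b s x j • w s x) k) (Ioo 0 T) volume :=
    fun j => h.integrableOn_mFourierCoeff_carrier_smul j k
  have hGi : ∀ j, IntegrableOn (fun s =>
      mFourierCoeff (FunctionSpaces.EuclideanSpace.complexify ∘ fun x => w s x j • b s x) k) (Ioo 0 T) volume :=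
    fun j => h.integrableOn_mFourierCoeff_smul_carrier j k
  have hFX : ∀ j, IntegrableOn (fun s =>
      ⟪mFourierCoeff (FunctionSpaces.EuclideanSpace.complexify ∘ fun x => b s x j • w s x) k,
        mFourierCoeff (FunctionSpaces.EuclideanSpace.complexify ∘ w s) k⟫_ℂ) (Ioo 0 T) volume := by
    intro j
    refine Integrable.mono' ((hFi j).norm.mul_const C₁) ((hFi j).aestronglyMeasurable.inner hXm) ?_
    filter_upwards [hXb] with s hs
    exact (norm_inner_le_norm _ _).trans (mul_le_mul_of_nonneg_left hs (norm_nonneg _))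
  have hGX : ∀ j, IntegrableOn (fun s =>
      ⟪mFourierCoeff (FunctionSpaces.EuclideanSpace.complexify ∘ fun x => w s x j • b s x) k,
        mFourierCoeff (FunctionSpaces.EuclideanSpace.complexify ∘ w s) k⟫_ℂ) (Ioo 0 T) volume := by
    intro j
    refine Integrable.mono' ((hGi j).norm.mul_const C₁) ((hGi j).aestronglyMeasurable.inner hXm) ?_
    filter_upwards [hXb] with s hs
    exact (norm_inner_le_norm _ _).trans (mul_le_mul_of_nonneg_left hs (norm_nonneg _))
  exact (integrable_finsetSum _ fun j _ => (hFX j).const_mul _).add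
    ((integrable_finsetSum _ fun j _ => (hGX j).const_mul _).const_mul _)

/-- Slice facts for a distorted solution with a carrier bounded by `M` a.e. on `(0,T) × T^d`: for a.e.
`τ`, `w(τ) ∈ L²`, and the products `bⱼ(τ) w(τ)`, `wⱼ(τ) b(τ)` satisfy
`∑ₖ ‖𝓕(·)(k)‖ₑ² ≤ M² ∫⁻ ‖w(τ)‖ₑ²` (Plancherel; any frame). [cite: Grafakos2014, Prop. 3.2.7 (3)] -/
theorem ae_tsum_enorm_sq_mFourierCoeff_products_le (h : IsWeakTensorPassiveVectorDistortedOn A T 𝔸 b G w₀ w)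
    {M : ℝ} (hM : 0 ≤ M)
    (hbM : ∀ᵐ q ∂(((volume : Measure ℝ).restrict (Ioo 0 T)).prod (volume : Measure (UnitAddTorus d))),
      ‖b q.1 q.2‖ ≤ M) :
    ∀ᵐ τ ∂(volume.restrict (Ioo 0 T)), MemLp (w τ) 2 volume ∧ ∀ j,
      (∑' k, ‖mFourierCoeff (FunctionSpaces.EuclideanSpace.complexify ∘ fun x => b τ x j • w τ x) k‖ₑ ^ 2 ≤
          ENNReal.ofReal (M ^ 2) * ∫⁻ x, ‖w τ x‖ₑ ^ 2) ∧
        (∑' k, ‖mFourierCoeff (FunctionSpaces.EuclideanSpace.complexify ∘ fun x => w τ x j • b τ x) k‖ₑ ^ 2 ≤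
          ENNReal.ofReal (M ^ 2) * ∫⁻ x, ‖w τ x‖ₑ ^ 2) := by
  filter_upwards [h.ae_memLp_two, h.ae_aestronglyMeasurable_slice, Measure.ae_ae_of_ae_prod hbM] with τ h1 h2 h3
  refine ⟨h1, fun j => ⟨?_, ?_⟩⟩
  · have hg : AEStronglyMeasurable (fun x => b τ x j • w τ x) volume :=
      ((EuclideanSpace.proj j).continuous.comp_aestronglyMeasurable h2.2).smul h2.1
    refine (tsum_enorm_sq_mFourierCoeff_le_of_norm_le h1 hg hM ?_).2
    filter_upwards [h3] with x hx
    show ‖b τ x j • w τ x‖ ≤ M * ‖w τ x‖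
    rw [norm_smul]
    refine mul_le_mul_of_nonneg_right ?_ (norm_nonneg _)
    exact (Real.norm_eq_abs _ ▸ FunctionSpaces.Torus.abs_apply_le_norm (b τ x) j).trans hx
  · have hg : AEStronglyMeasurable (fun x => w τ x j • b τ x) volume :=
      ((EuclideanSpace.proj j).continuous.comp_aestronglyMeasurable h2.1).smul h2.2
    refine (tsum_enorm_sq_mFourierCoeff_le_of_norm_le h1 hg hM ?_).2
    filter_upwards [h3] with x hx
    show ‖w τ x j • b τ x‖ ≤ M * ‖w τ x‖
    rw [norm_smul, mul_comm]
    refine mul_le_mul ?_ ?_ (norm_nonneg _) hM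
    · exact hx
    · exact Real.norm_eq_abs _ ▸ FunctionSpaces.Torus.abs_apply_le_norm (w τ x) j

/-- The flux energies `γ_k(τ) = ∑ⱼ (‖𝓕(bⱼw)(τ)(k)‖² + ‖𝓕(wⱼb)(τ)(k)‖²)` are integrable on `(0,T)` when
the carrier is bounded by `M` (any frame). [cite: RobinsonRodrigoSadowski2016, §4.2 (Galerkin energy estimate)] -/
theorem integrableOn_fluxEnergy (h : IsWeakTensorPassiveVectorDistortedOn A T 𝔸 b G w₀ w) {M : ℝ} (hM : 0 ≤ M)
    (hbM : ∀ᵐ q ∂(((volume : Measure ℝ).restrict (Ioo 0 T)).prod (volume : Measure (UnitAddTorus d))),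
      ‖b q.1 q.2‖ ≤ M) (k : d → ℤ) :
    IntegrableOn (fun τ => ∑ j,
      (‖mFourierCoeff (FunctionSpaces.EuclideanSpace.complexify ∘ fun x => b τ x j • w τ x) k‖ ^ 2 +
        ‖mFourierCoeff (FunctionSpaces.EuclideanSpace.complexify ∘ fun x => w τ x j • b τ x) k‖ ^ 2))
      (Ioo 0 T) volume := by
  obtain ⟨C, hC⟩ := h.ae_lintegral_sq_le
  have hFi : ∀ j, IntegrableOn (fun τ =>
      mFourierCoeff (FunctionSpaces.EuclideanSpace.complexify ∘ fun x => b τ x j • w τ x) k) (Ioo 0 T) volume :=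
    fun j => h.integrableOn_mFourierCoeff_carrier_smul j k
  have hGi : ∀ j, IntegrableOn (fun τ =>
      mFourierCoeff (FunctionSpaces.EuclideanSpace.complexify ∘ fun x => w τ x j • b τ x) k) (Ioo 0 T) volume :=
    fun j => h.integrableOn_mFourierCoeff_smul_carrier j k
  have hslice := h.ae_tsum_enorm_sq_mFourierCoeff_products_le hM hbM
  have hm : AEStronglyMeasurable (fun τ => ∑ j,
      (‖mFourierCoeff (FunctionSpaces.EuclideanSpace.complexify ∘ fun x => b τ x j • w τ x) k‖ ^ 2 +
        ‖mFourierCoeff (FunctionSpaces.EuclideanSpace.complexify ∘ fun x => w τ x j • b τ x) k‖ ^ 2))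
      (volume.restrict (Ioo 0 T)) :=
    Finset.aestronglyMeasurable_fun_sum _ fun j _ =>
      ((hFi j).aestronglyMeasurable.norm.pow 2).add ((hGi j).aestronglyMeasurable.norm.pow 2)
  refine IntegrableOn.of_bound measure_Ioo_lt_top hm (∑ _j : d, (M ^ 2 * C + M ^ 2 * C)) ?_
  filter_upwards [hslice, hC] with τ hτ hτC
  rw [Real.norm_eq_abs, abs_of_nonneg (Finset.sum_nonneg fun j _ => by positivity)]
  refine Finset.sum_le_sum fun j _ => ?_
  have conv : ∀ (X : EuclideanSpace ℂ d), ‖X‖ₑ ^ 2 ≤ ENNReal.ofReal (M ^ 2) * C → ‖X‖ ^ 2 ≤ M ^ 2 * C := by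
    intro X hX
    have h2 : ‖X‖ₑ ^ 2 = ENNReal.ofReal (‖X‖ ^ 2) := by
      rw [← ofReal_norm, ENNReal.ofReal_pow (norm_nonneg _)]
    rw [h2, ← ENNReal.ofReal_coe_nnreal, ← ENNReal.ofReal_mul (sq_nonneg _)] at hX
    exact (ENNReal.ofReal_le_ofReal_iff (by positivity)).1 hX
  exact add_le_add (conv _ (((ENNReal.le_tsum k).trans (hτ.2 j).1).trans (mul_le_mul_right hτC _)))
    (conv _ (((ENNReal.le_tsum k).trans (hτ.2 j).2).trans (mul_le_mul_right hτC _)))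

end IsWeakTensorPassiveVectorDistortedOn

end Kinematic

/-! ## §2 Constant frame: the energy identity of one mode and the modewise dissipation bound -/

section ModeEnergy

variable [DecidableEq d]

namespace IsWeakTensorPassiveVectorDistortedOn

variable {A T : ℝ} {𝔸 : Visc4 d} {b w : ℝ → UnitAddTorus d → EuclideanSpace ℝ d}
  {G₀ : Matrix d d ℝ} {w₀ : UnitAddTorus d → EuclideanSpace ℝ d}

/-- Integrability on `(0,T)` of the right-hand side
`Φ_Γ = ∫⟪w, (b·∇)Γ + 𝓛_{𝔸^{G₀}}^* Γ⟫ + A ∫⟪b, (w·∇)Γ⟫` of the constant-frame steady-test identity, for a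
smooth steady field `Γ`. [cite: DiPernaLions1989, §II.1 (12)–(14)] -/
theorem integrableOn_steadyRHS_constFrame (h : IsWeakTensorPassiveVectorDistortedOn A T 𝔸 b (fun _ _ => G₀) w₀ w)
    {Γ : UnitAddTorus d → EuclideanSpace ℝ d} (hΓ : FunctionSpaces.Torus.IsSmooth Γ) :
    IntegrableOn (fun τ =>
      (∫ x, ⟪w τ x, FunctionSpaces.Torus.convect (b τ) Γ x + viscAdj (Visc4.conj G₀ 𝔸) Γ x⟫_ℝ) +
        A * ∫ x, ⟪b τ x, FunctionSpaces.Torus.convect (w τ) Γ x⟫_ℝ) (Ioo 0 T) volume := by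
  have hΓ1 : FunctionSpaces.Torus.IsContDiff 1 Γ := hΓ.isContDiff (by simp)
  have hΓd : ∀ j, Continuous (uncurry fun (_ : ℝ) (x : UnitAddTorus d) => FunctionSpaces.Torus.partialDeriv j Γ x) :=
    fun j => (hΓ.partialDeriv j).continuous.comp continuous_snd
  have hΓl : Continuous (uncurry fun (_ : ℝ) (x : UnitAddTorus d) => viscAdj (Visc4.conj G₀ 𝔸) Γ x) := by
    have hc : Continuous (viscAdj (Visc4.conj G₀ 𝔸) Γ) := (isSmooth_viscAdj (Visc4.conj G₀ 𝔸) hΓ).continuous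
    exact hc.comp continuous_snd
  have hIv : Integrable (fun p : ℝ × UnitAddTorus d => ⟪w p.1 p.2, viscAdj (Visc4.conj G₀ 𝔸) Γ p.2⟫_ℝ)
      (((volume : Measure ℝ).restrict (Ioo 0 T)).prod volume) :=
    h.integrable_inner_of_continuous (Φ := fun _ x => viscAdj (Visc4.conj G₀ 𝔸) Γ x) hΓl
  have hIc : Integrable (fun p : ℝ × UnitAddTorus d =>
      ⟪w p.1 p.2, FunctionSpaces.Torus.convect (b p.1) Γ p.2⟫_ℝ)
      (((volume : Measure ℝ).restrict (Ioo 0 T)).prod volume) :=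
    h.integrable_inner_convect (Φ := fun _ => Γ) (fun _ => hΓ1) hΓd
  have hI₂ : Integrable (fun p : ℝ × UnitAddTorus d =>
      ⟪w p.1 p.2, FunctionSpaces.Torus.convect (b p.1) Γ p.2 + viscAdj (Visc4.conj G₀ 𝔸) Γ p.2⟫_ℝ)
      (((volume : Measure ℝ).restrict (Ioo 0 T)).prod volume) := by
    refine (hIc.add hIv).congr (Eventually.of_forall fun p => ?_)
    simp only [Pi.add_apply]
    rw [inner_add_right]
  have hI₃ : Integrable (fun p : ℝ × UnitAddTorus d => A * ⟪b p.1 p.2, FunctionSpaces.Torus.convect (w p.1) Γ p.2⟫_ℝ)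
      (((volume : Measure ℝ).restrict (Ioo 0 T)).prod volume) :=
    (h.integrable_inner_carrier_convect (Φ := fun _ => Γ) (fun _ => hΓ1) hΓd).const_mul A
  refine (hI₂.integral_prod_left.add hI₃.integral_prod_left).congr (Eventually.of_forall fun t => ?_)
  simp only [Pi.add_apply]
  rw [integral_const_mul]

/-- **Per-mode energy identity, physical-space form (constant frame).** For a steady smooth field `Γ`
with `∇·(G₀ Γ) = 0` and a.e. `t ∈ (0,T)`:
`(∫⟪w(t), Γ⟫)² = (∫⟪w₀, Γ⟫)² + 2 ∫_{(0,t]} Φ_Γ(τ) (∫⟪w(τ), Γ⟫) dτ`,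
`Φ_Γ(τ) = ∫⟪w(τ), (b(τ)·∇)Γ + 𝓛_{𝔸^{G₀}}^* Γ⟫ + A ∫⟪b(τ), (w(τ)·∇)Γ⟫`.
[cite: RobinsonRodrigoSadowski2016, §4.2 (Galerkin energy estimate)] [cite: ArmstrongVicol2025, §4.1 (PDF p. 34)] -/
theorem ae_mode_energy_eq_constFrame (h : IsWeakTensorPassiveVectorDistortedOn A T 𝔸 b (fun _ _ => G₀) w₀ w)
    {Γ : UnitAddTorus d → EuclideanSpace ℝ d} (hΓ : FunctionSpaces.Torus.IsSmooth Γ)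
    (hΓdiv : FunctionSpaces.Torus.IsDivFree (distort (fun _ => G₀) Γ)) :
    ∀ᵐ t ∂(volume.restrict (Ioo 0 T)),
      (∫ x, ⟪w t x, Γ x⟫_ℝ) ^ 2 = (∫ x, ⟪w₀ x, Γ x⟫_ℝ) ^ 2 +
        2 * ∫ τ in Ioc 0 t,
          ((∫ x, ⟪w τ x, FunctionSpaces.Torus.convect (b τ) Γ x + viscAdj (Visc4.conj G₀ 𝔸) Γ x⟫_ℝ) +
            A * ∫ x, ⟪b τ x, FunctionSpaces.Torus.convect (w τ) Γ x⟫_ℝ) * ∫ x, ⟪w τ x, Γ x⟫_ℝ :=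
  ae_sq_eq_of_ae_eq_add_setIntegral_cf (h.integrableOn_steadyRHS_constFrame hΓ) (h.ae_integral_inner_eq_constFrame hΓ hΓdiv)

/-- **Per-mode energy identity in Fourier variables (tested form, constant frame).** For a frequency
`k`, a vector `z ∈ ℂ^d` transversal to the TWISTED frequency (`(G₀ᵀk) · z = 0`) and a.e. `t ∈ (0,T)`,
with `α(t) = ⟪ŵ(t)(k), z⟫_ℂ` and `H_τ(z) = −4π² ⟪ŵ(τ)(k), T_{𝔸^{G₀}}(k) z⟫ + B_τ(z)`:
`|α(t)|² = |⟪ŵ₀(k), z⟫|² + 2 ∫_{(0,t]} Re (conj α(τ) · H_τ(z)) dτ`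
(real and imaginary parts of `ae_inner_mFourierCoeff_eq_constFrame`, squared by the product rule for
a.e. primitives and added). [cite: RobinsonRodrigoSadowski2016, §4.2 (Galerkin energy estimate)]
[cite: ArmstrongVicol2025, §4.1 (PDF p. 34)] -/
theorem ae_sq_norm_inner_mFourierCoeff_eq_constFrame
    (h : IsWeakTensorPassiveVectorDistortedOn A T 𝔸 b (fun _ _ => G₀) w₀ w)
    (hw₀ : Integrable w₀ volume) (k : d → ℤ) {z : EuclideanSpace ℂ d}
    (hz : rdot (twistFreq G₀ k) z = 0) :
    ∀ᵐ t ∂(volume.restrict (Ioo 0 T)),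
      ‖⟪mFourierCoeff (FunctionSpaces.EuclideanSpace.complexify ∘ w t) k, z⟫_ℂ‖ ^ 2 =
        ‖⟪mFourierCoeff (FunctionSpaces.EuclideanSpace.complexify ∘ w₀) k, z⟫_ℂ‖ ^ 2 +
        2 * ∫ τ in Ioc 0 t,
          (conj ⟪mFourierCoeff (FunctionSpaces.EuclideanSpace.complexify ∘ w τ) k, z⟫_ℂ *
            ((-(4 * Real.pi ^ 2 : ℝ) : ℂ) *
                ⟪mFourierCoeff (FunctionSpaces.EuclideanSpace.complexify ∘ w τ) k, symbT (Visc4.conj G₀ 𝔸) k z⟫_ℂ +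
              ((∑ j, (2 * Real.pi * I * (k j)) *
                  ⟪mFourierCoeff (FunctionSpaces.EuclideanSpace.complexify ∘ fun x => b τ x j • w τ x) k, z⟫_ℂ) +
                (A : ℂ) * ∑ j, (2 * Real.pi * I * (k j)) *
                  ⟪mFourierCoeff (FunctionSpaces.EuclideanSpace.complexify ∘ fun x => w τ x j • b τ x) k, z⟫_ℂ))).re := by
  -- names
  set α : ℝ → ℂ := fun t => ⟪mFourierCoeff (FunctionSpaces.EuclideanSpace.complexify ∘ w t) k, z⟫_ℂ with hα
  set α₀ : ℂ := ⟪mFourierCoeff (FunctionSpaces.EuclideanSpace.complexify ∘ w₀) k, z⟫_ℂ with hα₀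
  set H : ℝ → ℂ := fun τ => (-(4 * Real.pi ^ 2 : ℝ) : ℂ) *
      ⟪mFourierCoeff (FunctionSpaces.EuclideanSpace.complexify ∘ w τ) k, symbT (Visc4.conj G₀ 𝔸) k z⟫_ℂ +
    ((∑ j, (2 * Real.pi * I * (k j)) *
        ⟪mFourierCoeff (FunctionSpaces.EuclideanSpace.complexify ∘ fun x => b τ x j • w τ x) k, z⟫_ℂ) +
      (A : ℂ) * ∑ j, (2 * Real.pi * I * (k j)) *
        ⟪mFourierCoeff (FunctionSpaces.EuclideanSpace.complexify ∘ fun x => w τ x j • b τ x) k, z⟫_ℂ) with hH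
  have hHi : IntegrableOn H (Ioo 0 T) volume := h.integrableOn_modeRHS (Visc4.conj G₀ 𝔸) k z
  -- the twisted transversality in the `vecMul` form of the constant-frame identity
  have hz' : ∑ b', ((Matrix.vecMul (fun a => (k a : ℝ)) G₀ b' : ℝ) : ℂ) * z b' = 0 := by
    rw [← rdot_twistFreq]; exact hz
  -- the modewise identity and its real and imaginary parts
  have hid : ∀ᵐ t ∂(volume.restrict (Ioo 0 T)), α t = α₀ + ∫ τ in Ioc 0 t, H τ :=
    h.ae_inner_mFourierCoeff_eq_constFrame hw₀ k hz'
  have hre : ∀ᵐ t ∂(volume.restrict (Ioo 0 T)), (α t).re = α₀.re + ∫ τ in Ioc 0 t, (H τ).re := by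
    filter_upwards [hid, ae_restrict_mem measurableSet_Ioo] with t ht htT
    rw [ht, Complex.add_re, re_integral_eq (hHi.mono_set (Ioc_subset_Ioo_right htT.2))]
  have him : ∀ᵐ t ∂(volume.restrict (Ioo 0 T)), (α t).im = α₀.im + ∫ τ in Ioc 0 t, (H τ).im := by
    filter_upwards [hid, ae_restrict_mem measurableSet_Ioo] with t ht htT
    rw [ht, Complex.add_im, im_integral_eq (hHi.mono_set (Ioc_subset_Ioo_right htT.2))]
  have h1 := ae_sq_eq_of_ae_eq_add_setIntegral_cf hHi.re hre
  have h2 := ae_sq_eq_of_ae_eq_add_setIntegral_cf hHi.im him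
  -- integrability of the products on `(0,T)`
  have hαi : IntegrableOn α (Ioo 0 T) volume := (h.integrableOn_mFourierCoeff k).inner_const z
  obtain ⟨K, hK⟩ := h.exists_ae_norm_inner_mFourierCoeff_le k z
  have hP1 : IntegrableOn (fun τ => (H τ).re * (α τ).re) (Ioo 0 T) volume := by
    have hαm : AEStronglyMeasurable (fun τ => (α τ).re) (volume.restrict (Ioo 0 T)) :=
      Complex.continuous_re.comp_aestronglyMeasurable hαi.aestronglyMeasurable
    refine Integrable.mul_bdd (c := K) hHi.re hαm ?_
    filter_upwards [hK] with τ hτ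
    rw [Real.norm_eq_abs]
    exact (Complex.abs_re_le_norm _).trans hτ
  have hP2 : IntegrableOn (fun τ => (H τ).im * (α τ).im) (Ioo 0 T) volume := by
    have hαm : AEStronglyMeasurable (fun τ => (α τ).im) (volume.restrict (Ioo 0 T)) :=
      Complex.continuous_im.comp_aestronglyMeasurable hαi.aestronglyMeasurable
    refine Integrable.mul_bdd (c := K) hHi.im hαm ?_
    filter_upwards [hK] with τ hτ
    rw [Real.norm_eq_abs]
    exact (Complex.abs_im_le_norm _).trans hτ
  filter_upwards [h1, h2, ae_restrict_mem measurableSet_Ioo] with t ht1 ht2 htT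
  simp only [RCLike.re_to_complex, RCLike.im_to_complex] at ht1 ht2
  have hsub : Ioc 0 t ⊆ Ioo 0 T := Ioc_subset_Ioo_right htT.2
  -- assemble `|α|² = re² + im²`
  rw [norm_sq_eq_re_sq_add_im_sq_cf, norm_sq_eq_re_sq_add_im_sq_cf α₀]
  rw [show (⟪mFourierCoeff (FunctionSpaces.EuclideanSpace.complexify ∘ w t) k, z⟫_ℂ) = α t from rfl, ht1, ht2,
    add_add_add_comm, ← mul_add, ← integral_add (hP1.mono_set hsub) (hP2.mono_set hsub)]
  congr 2
  refine integral_congr_ae (ae_of_all _ fun τ => ?_)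
  have e1 : (H τ).re * (α τ).re + (H τ).im * (α τ).im = (conj (α τ) * H τ).re := by
    rw [← re_mul_re_add_im_mul_im_cf]
    ring
  exact e1

/-- The zero mode of a constant-frame distorted weak solution is constant: `ŵ(t)(0) = ŵ₀(0)` for a.e.
`t` (test with the constant fields `eᵢ`, all admissible since `G₀ᵀ0 = 0`; `T(0) = 0`).
[cite: RobinsonRodrigoSadowski2016, §4.2 (Galerkin energy estimate)] -/
theorem ae_mFourierCoeff_zero_eq_constFrame (h : IsWeakTensorPassiveVectorDistortedOn A T 𝔸 b (fun _ _ => G₀) w₀ w)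
    (hw₀ : Integrable w₀ volume) :
    ∀ᵐ t ∂(volume.restrict (Ioo 0 T)),
      mFourierCoeff (FunctionSpaces.EuclideanSpace.complexify ∘ w t) 0 =
        mFourierCoeff (FunctionSpaces.EuclideanSpace.complexify ∘ w₀) 0 := by
  have hz : ∀ i : d, ∑ b', ((Matrix.vecMul (fun a => ((0 : d → ℤ) a : ℝ)) G₀ b' : ℝ) : ℂ) *
      (EuclideanSpace.single i (1 : ℂ) : EuclideanSpace ℂ d) b' = 0 := by
    intro i
    refine Finset.sum_eq_zero fun b' _ => ?_
    rw [ofReal_vecMul_intCast_apply]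
    simp
  have hall := ae_all_iff.2 fun i => h.ae_inner_mFourierCoeff_eq_constFrame hw₀ 0 (hz i)
  filter_upwards [hall] with t ht
  ext i
  have hi := ht i
  have h0 : ∫ τ in Ioc 0 t,
      ((-(4 * Real.pi ^ 2 : ℝ) : ℂ) *
          ⟪mFourierCoeff (FunctionSpaces.EuclideanSpace.complexify ∘ w τ) 0,
            symbT (Visc4.conj G₀ 𝔸) 0 (EuclideanSpace.single i (1 : ℂ))⟫_ℂ +
        ((∑ j, (2 * Real.pi * I * ((0 : d → ℤ) j)) *
            ⟪mFourierCoeff (FunctionSpaces.EuclideanSpace.complexify ∘ fun x => b τ x j • w τ x) 0,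
              EuclideanSpace.single i (1 : ℂ)⟫_ℂ) +
          (A : ℂ) * ∑ j, (2 * Real.pi * I * ((0 : d → ℤ) j)) *
            ⟪mFourierCoeff (FunctionSpaces.EuclideanSpace.complexify ∘ fun x => w τ x j • b τ x) 0,
              EuclideanSpace.single i (1 : ℂ)⟫_ℂ)) = 0 := by
    rw [integral_congr_ae (ae_of_all _ fun τ => ?_), integral_zero]
    simp
  rw [h0, add_zero, EuclideanSpace.inner_single_right, EuclideanSpace.inner_single_right, one_mul, one_mul] at hi
  exact (starRingEnd ℂ).injective hi

/-- **The energy identity of one Fourier mode, vector form (constant frame).** For a constant-frame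
distorted weak solution with datum `w₀ ∈ L²` satisfying the distorted constraint `∇·(G₀ w₀) = 0` weakly,
every frequency `k` and a.e. `t ∈ (0,T)`:
`‖ŵ(t)(k)‖² = ‖ŵ₀(k)‖² + 2 ∫_{(0,t]} Re (−4π² ⟪ŵ(τ)(k), T_{𝔸^{G₀}}(k) ŵ(τ)(k)⟫ + B_τ(ŵ(τ)(k))) dτ`,
`B_τ(z) = ∑ⱼ 2πikⱼ ⟪𝓕(bⱼw)(τ)(k), z⟫ + A ∑ⱼ 2πikⱼ ⟪𝓕(wⱼb)(τ)(k), z⟫` (the tested identities summed over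
an orthonormal basis of `(G₀ᵀk)^⊥ ⊂ ℂ^d`, in which `ŵ(τ)(k)` lies for a.e. `τ` and `ŵ₀(k)` lies;
Robinson–Rodrigo–Sadowski 2016, §4.2, with Frisch's tensor conjugated by the frozen frame).
[cite: RobinsonRodrigoSadowski2016, §4.2 (Galerkin energy estimate)] [cite: ArmstrongVicol2025, §4.1 (PDF p. 34)]
[cite: Frisch1995Turbulence, §9.6.3 eq. (9.57) p. 233] -/
theorem ae_sq_norm_mFourierCoeff_eq_constFrame (h : IsWeakTensorPassiveVectorDistortedOn A T 𝔸 b (fun _ _ => G₀) w₀ w)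
    (hw₀ : MemLp w₀ 2 volume) (hdiv₀ : FunctionSpaces.Torus.IsWeaklyDivFree (distort (fun _ => G₀) w₀))
    (k : d → ℤ) :
    ∀ᵐ t ∂(volume.restrict (Ioo 0 T)),
      ‖mFourierCoeff (FunctionSpaces.EuclideanSpace.complexify ∘ w t) k‖ ^ 2 =
        ‖mFourierCoeff (FunctionSpaces.EuclideanSpace.complexify ∘ w₀) k‖ ^ 2 +
        2 * ∫ τ in Ioc 0 t,
          ((-(4 * Real.pi ^ 2 : ℝ) : ℂ) *
              ⟪mFourierCoeff (FunctionSpaces.EuclideanSpace.complexify ∘ w τ) k,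
                symbT (Visc4.conj G₀ 𝔸) k (mFourierCoeff (FunctionSpaces.EuclideanSpace.complexify ∘ w τ) k)⟫_ℂ +
            ((∑ j, (2 * Real.pi * I * (k j)) *
                ⟪mFourierCoeff (FunctionSpaces.EuclideanSpace.complexify ∘ fun x => b τ x j • w τ x) k,
                  mFourierCoeff (FunctionSpaces.EuclideanSpace.complexify ∘ w τ) k⟫_ℂ) +
              (A : ℂ) * ∑ j, (2 * Real.pi * I * (k j)) *
                ⟪mFourierCoeff (FunctionSpaces.EuclideanSpace.complexify ∘ fun x => w τ x j • b τ x) k,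
                  mFourierCoeff (FunctionSpaces.EuclideanSpace.complexify ∘ w τ) k⟫_ℂ)).re := by
  have hw₀i : Integrable w₀ volume := hw₀.integrable one_le_two
  -- names
  set X : ℝ → EuclideanSpace ℂ d := fun t => mFourierCoeff (FunctionSpaces.EuclideanSpace.complexify ∘ w t) k with hX
  set X₀ : EuclideanSpace ℂ d := mFourierCoeff (FunctionSpaces.EuclideanSpace.complexify ∘ w₀) k with hX₀
  set F : d → ℝ → EuclideanSpace ℂ d := fun j τ =>
    mFourierCoeff (FunctionSpaces.EuclideanSpace.complexify ∘ fun x => b τ x j • w τ x) k with hF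
  set G : d → ℝ → EuclideanSpace ℂ d := fun j τ =>
    mFourierCoeff (FunctionSpaces.EuclideanSpace.complexify ∘ fun x => w τ x j • b τ x) k with hGdef
  -- sum the tested identities over an orthonormal basis of the twisted plane `(G₀ᵀk)^⊥`
  set S : Submodule ℂ (EuclideanSpace ℂ d) := (ℂ ∙ waveVecRC (twistFreq G₀ k))ᗮ with hS
  let bS := stdOrthonormalBasis ℂ S
  set e : Fin (Module.finrank ℂ S) → EuclideanSpace ℂ d := fun i => (bS i : EuclideanSpace ℂ d) with he
  have he_tr : ∀ i, rdot (twistFreq G₀ k) (e i) = 0 := fun i =>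
    (mem_orthogonal_waveVecRC_iff (twistFreq G₀ k) _).1 (bS i).2
  have hX₀S : X₀ ∈ S := (mem_orthogonal_waveVecRC_iff (twistFreq G₀ k) X₀).2
    (rdot_twistFreq_mFourierCoeff_eq_zero_of_isWeaklyDivFree_distort G₀ hw₀ hdiv₀ k)
  have hXt : ∀ᵐ τ ∂(volume.restrict (Ioo 0 T)), rdot (twistFreq G₀ k) (X τ) = 0 := by
    filter_upwards [h.ae_sum_vecMul_mul_mFourierCoeff_eq_zero] with τ hτ
    rw [rdot_twistFreq]
    exact hτ k
  -- the mode right-hand side at `z`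
  set H : EuclideanSpace ℂ d → ℝ → ℂ := fun z τ =>
    (-(4 * Real.pi ^ 2 : ℝ) : ℂ) * ⟪X τ, symbT (Visc4.conj G₀ 𝔸) k z⟫_ℂ +
      ((∑ j, (2 * Real.pi * I * (k j)) * ⟪F j τ, z⟫_ℂ) + (A : ℂ) * ∑ j, (2 * Real.pi * I * (k j)) * ⟪G j τ, z⟫_ℂ)
    with hH
  have hHi : ∀ z, IntegrableOn (H z) (Ioo 0 T) volume := fun z => h.integrableOn_modeRHS (Visc4.conj G₀ 𝔸) k z
  have hall := ae_all_iff.2 fun i => h.ae_sq_norm_inner_mFourierCoeff_eq_constFrame hw₀i k (z := e i) (he_tr i)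
  -- integrability of the summands on `(0,T)`
  have hIi : ∀ i, IntegrableOn (fun τ => (conj ⟪X τ, e i⟫_ℂ * H (e i) τ).re) (Ioo 0 T) volume :=
    fun i => (h.integrableOn_conj_inner_mul k (e i) (hHi (e i))).re
  -- the pointwise basis identity for a transversal `X τ`
  have hframe : ∀ᵐ τ ∂(volume.restrict (Ioo 0 T)),
      ∑ i, (conj ⟪X τ, e i⟫_ℂ * H (e i) τ).re = (H (X τ) τ).re := by
    filter_upwards [hXt] with τ hτ
    have hXS : X τ ∈ S := (mem_orthogonal_waveVecRC_iff (twistFreq G₀ k) (X τ)).2 hτ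
    rw [← Complex.re_sum]
    congr 1
    have hlin := modeRHS_sum_smul_cf Finset.univ (Visc4.conj G₀ 𝔸) k A (X τ) (fun j => F j τ) (fun j => G j τ)
      (fun i => conj ⟪X τ, e i⟫_ℂ) e
    rw [sum_conj_inner_smul_onb_cf bS hXS] at hlin
    rw [hH]
    exact hlin.symm
  filter_upwards [hall, hXt, ae_restrict_mem measurableSet_Ioo] with t ht hXtt htT
  have hsub : Ioc 0 t ⊆ Ioo 0 T := Ioc_subset_Ioo_right htT.2
  have hXS : X t ∈ S := (mem_orthogonal_waveVecRC_iff (twistFreq G₀ k) (X t)).2 hXtt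
  -- sum the basis identities
  have hsum : ∑ i, ‖⟪X t, e i⟫_ℂ‖ ^ 2 = ∑ i, (‖⟪X₀, e i⟫_ℂ‖ ^ 2 +
      2 * ∫ τ in Ioc 0 t, (conj ⟪X τ, e i⟫_ℂ * H (e i) τ).re) :=
    Finset.sum_congr rfl fun i _ => ht i
  rw [sum_sq_norm_inner_onb_cf bS hXS, Finset.sum_add_distrib, sum_sq_norm_inner_onb_cf bS hX₀S, ← Finset.mul_sum,
    ← integral_finsetSum _ (fun i _ => (hIi i).mono_set hsub),
    integral_congr_ae (ae_restrict_of_ae_restrict_of_subset hsub hframe)] at hsum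
  rw [hX] at hsum
  exact hsum

/-- **The modewise dissipation bound (constant NON-DEGENERATE frame, tensor in a Legendre–Hadamard
window).** For `NearIso 𝔸 lo hi` with `0 < lo`, a frame with `c |k|² ≤ |G₀ᵀk|²` for all `k` (`0 < c`),
a carrier bounded by `M` a.e. on `(0,T) × T^d`, a datum `w₀ ∈ L²` with `∇·(G₀ w₀) = 0` weakly, every `k`
and a.e. `t ∈ (0,T)`:
`‖ŵ(t)(k)‖² + 4π² lo |G₀ᵀk|² ∫_{(0,t]} ‖ŵ(τ)(k)‖² dτ ≤ ‖ŵ₀(k)‖² + ((1 + A²)/(lo c)) ∫_{(0,t]} γ_k(τ) dτ`,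
`γ_k = ∑ⱼ (‖𝓕(bⱼw)(k)‖² + ‖𝓕(wⱼb)(k)‖²)`, `|G₀ᵀk|² = Σ_a (twistFreq G₀ k a)²` (the energy identity of
the mode, the twisted coercivity `lo|G₀ᵀk|²‖X‖² ≤ Re ⟪X, T_{𝔸^{G₀}}(k) X⟫` on `(G₀ᵀk)^⊥` and Young's
inequality `2 Re B(X) ≤ 4π² (lo c)|k|²‖X‖² + (1+A²)γ_k/(lo c) ≤ 4π² lo|G₀ᵀk|²‖X‖² + (1+A²)γ_k/(lo c)`;
Robinson–Rodrigo–Sadowski 2016, (4.20), mode by mode, with `ν|k|² ↦ lo|G₀ᵀk|²`).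
[cite: RobinsonRodrigoSadowski2016, §4.2 (4.20)] [cite: Giaquinta1983MultipleIntegrals, Ch. III §2 eq. (2.2)]
[cite: ArmstrongVicol2025, §4.1 (PDF p. 34)] -/
theorem ae_sq_norm_add_dissipation_le_constFrame (h : IsWeakTensorPassiveVectorDistortedOn A T 𝔸 b (fun _ _ => G₀) w₀ w)
    {lo hi : ℝ} (h𝔸 : NearIso 𝔸 lo hi) (hlo : 0 < lo)
    {c : ℝ} (hc : 0 < c) (hG : ∀ k : d → ℤ, c * FunctionSpaces.Torus.freqNormSq k ≤ ∑ a, twistFreq G₀ k a ^ 2)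
    (hw₀ : MemLp w₀ 2 volume) (hdiv₀ : FunctionSpaces.Torus.IsWeaklyDivFree (distort (fun _ => G₀) w₀))
    {M : ℝ} (hM : 0 ≤ M)
    (hbM : ∀ᵐ q ∂(((volume : Measure ℝ).restrict (Ioo 0 T)).prod (volume : Measure (UnitAddTorus d))),
      ‖b q.1 q.2‖ ≤ M) (k : d → ℤ) :
    ∀ᵐ t ∂(volume.restrict (Ioo 0 T)),
      ‖mFourierCoeff (FunctionSpaces.EuclideanSpace.complexify ∘ w t) k‖ ^ 2 +
          4 * Real.pi ^ 2 * lo * (∑ a, twistFreq G₀ k a ^ 2) *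
            ∫ τ in Ioc 0 t, ‖mFourierCoeff (FunctionSpaces.EuclideanSpace.complexify ∘ w τ) k‖ ^ 2 ≤
        ‖mFourierCoeff (FunctionSpaces.EuclideanSpace.complexify ∘ w₀) k‖ ^ 2 +
          ((1 + A ^ 2) / (lo * c)) * ∫ τ in Ioc 0 t, ∑ j,
            (‖mFourierCoeff (FunctionSpaces.EuclideanSpace.complexify ∘ fun x => b τ x j • w τ x) k‖ ^ 2 +
              ‖mFourierCoeff (FunctionSpaces.EuclideanSpace.complexify ∘ fun x => w τ x j • b τ x) k‖ ^ 2) := by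
  set Λ : ℝ := ∑ a, twistFreq G₀ k a ^ 2 with hΛ
  set X : ℝ → EuclideanSpace ℂ d := fun t => mFourierCoeff (FunctionSpaces.EuclideanSpace.complexify ∘ w t) k with hX
  set F : d → ℝ → EuclideanSpace ℂ d := fun j τ =>
    mFourierCoeff (FunctionSpaces.EuclideanSpace.complexify ∘ fun x => b τ x j • w τ x) k with hF
  set G : d → ℝ → EuclideanSpace ℂ d := fun j τ =>
    mFourierCoeff (FunctionSpaces.EuclideanSpace.complexify ∘ fun x => w τ x j • b τ x) k with hGdef
  set γ : ℝ → ℝ := fun τ => ∑ j, (‖F j τ‖ ^ 2 + ‖G j τ‖ ^ 2) with hγ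
  have hγi : IntegrableOn γ (Ioo 0 T) volume := h.integrableOn_fluxEnergy hM hbM k
  obtain ⟨C₁, hC₁0, hXb⟩ := h.exists_ae_norm_mFourierCoeff_le k
  have hXm : AEStronglyMeasurable X (volume.restrict (Ioo 0 T)) := (h.integrableOn_mFourierCoeff k).aestronglyMeasurable
  have hI3 : IntegrableOn (fun τ => ‖X τ‖ ^ 2) (Ioo 0 T) volume := h.integrableOn_norm_sq_mFourierCoeff k
  -- `Re H_τ(X τ)` is integrable
  have hBi : IntegrableOn (fun τ => ((∑ j, (2 * Real.pi * I * (k j)) * ⟪F j τ, X τ⟫_ℂ) +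
      (A : ℂ) * ∑ j, (2 * Real.pi * I * (k j)) * ⟪G j τ, X τ⟫_ℂ)) (Ioo 0 T) volume := h.integrableOn_modeRHS_self k
  have hTi : IntegrableOn (fun τ => ⟪X τ, symbT (Visc4.conj G₀ 𝔸) k (X τ)⟫_ℂ) (Ioo 0 T) volume :=
    h.integrableOn_inner_symbT (Visc4.conj G₀ 𝔸) k
  have hHi : IntegrableOn (fun τ => ((-(4 * Real.pi ^ 2 : ℝ) : ℂ) * ⟪X τ, symbT (Visc4.conj G₀ 𝔸) k (X τ)⟫_ℂ +
      ((∑ j, (2 * Real.pi * I * (k j)) * ⟪F j τ, X τ⟫_ℂ) +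
        (A : ℂ) * ∑ j, (2 * Real.pi * I * (k j)) * ⟪G j τ, X τ⟫_ℂ)).re) (Ioo 0 T) volume :=
    ((hTi.const_mul _).add hBi).re
  have hloc : 0 < lo * c := mul_pos hlo hc
  set ν' : ℝ := 4 * Real.pi ^ 2 * lo * Λ with hν'
  set c' : ℝ := (1 + A ^ 2) / (lo * c) with hc'
  -- the pointwise (a.e.) inequality `2 Re H_τ(X τ) ≤ -ν' ‖X τ‖² + c' γ τ`
  have hpt : ∀ᵐ τ ∂(volume.restrict (Ioo 0 T)),
      2 * ((-(4 * Real.pi ^ 2 : ℝ) : ℂ) * ⟪X τ, symbT (Visc4.conj G₀ 𝔸) k (X τ)⟫_ℂ +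
        ((∑ j, (2 * Real.pi * I * (k j)) * ⟪F j τ, X τ⟫_ℂ) +
          (A : ℂ) * ∑ j, (2 * Real.pi * I * (k j)) * ⟪G j τ, X τ⟫_ℂ)).re ≤ -ν' * ‖X τ‖ ^ 2 + c' * γ τ := by
    filter_upwards [h.ae_sum_vecMul_mul_mFourierCoeff_eq_zero] with τ hτ
    have hτk : rdot (twistFreq G₀ k) (X τ) = 0 := by rw [rdot_twistFreq]; exact hτ k
    have hco := lo_mul_le_re_inner_symbT_conj h𝔸 G₀ (k := k) (z := X τ) hτk
    have hY := two_mul_re_modeRHS_le_cf hloc A k (X τ) (fun j => F j τ) (fun j => G j τ)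
    have hGk := hG k
    have hXn : 0 ≤ ‖X τ‖ ^ 2 := sq_nonneg _
    have hfr : 4 * Real.pi ^ 2 * (lo * c) * FunctionSpaces.Torus.freqNormSq k * ‖X τ‖ ^ 2 ≤
        4 * Real.pi ^ 2 * lo * Λ * ‖X τ‖ ^ 2 := by
      have h1 : lo * (c * FunctionSpaces.Torus.freqNormSq k) ≤ lo * Λ := mul_le_mul_of_nonneg_left hGk hlo.le
      have h2 : lo * (c * FunctionSpaces.Torus.freqNormSq k) * ‖X τ‖ ^ 2 ≤ lo * Λ * ‖X τ‖ ^ 2 :=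
        mul_le_mul_of_nonneg_right h1 hXn
      have h3 : 4 * Real.pi ^ 2 * (lo * (c * FunctionSpaces.Torus.freqNormSq k) * ‖X τ‖ ^ 2) ≤
          4 * Real.pi ^ 2 * (lo * Λ * ‖X τ‖ ^ 2) := mul_le_mul_of_nonneg_left h2 (by positivity)
      calc 4 * Real.pi ^ 2 * (lo * c) * FunctionSpaces.Torus.freqNormSq k * ‖X τ‖ ^ 2
          = 4 * Real.pi ^ 2 * (lo * (c * FunctionSpaces.Torus.freqNormSq k) * ‖X τ‖ ^ 2) := by ring
        _ ≤ 4 * Real.pi ^ 2 * (lo * Λ * ‖X τ‖ ^ 2) := h3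
        _ = 4 * Real.pi ^ 2 * lo * Λ * ‖X τ‖ ^ 2 := by ring
    rw [Complex.add_re, neg_mul, Complex.neg_re, Complex.re_ofReal_mul, hγ, hc', hν']
    simp only
    nlinarith [hco, hY, hfr, Real.pi_pos]
  filter_upwards [h.ae_sq_norm_mFourierCoeff_eq_constFrame hw₀ hdiv₀ k, ae_restrict_mem measurableSet_Ioo] with t ht htT
  have hsub : Ioc 0 t ⊆ Ioo 0 T := Ioc_subset_Ioo_right htT.2
  have haT : IntegrableOn (fun τ => -ν' * ‖X τ‖ ^ 2) (Ioo 0 T) volume := hI3.const_mul (-ν')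
  have hcT : IntegrableOn (fun τ => c' * γ τ) (Ioo 0 T) volume := hγi.const_mul c'
  have hgT : IntegrableOn (fun τ => -ν' * ‖X τ‖ ^ 2 + c' * γ τ) (Ioo 0 T) volume := haT.add hcT
  have hle : ∫ τ in Ioc 0 t, 2 * ((-(4 * Real.pi ^ 2 : ℝ) : ℂ) * ⟪X τ, symbT (Visc4.conj G₀ 𝔸) k (X τ)⟫_ℂ +
      ((∑ j, (2 * Real.pi * I * (k j)) * ⟪F j τ, X τ⟫_ℂ) +
        (A : ℂ) * ∑ j, (2 * Real.pi * I * (k j)) * ⟪G j τ, X τ⟫_ℂ)).re ≤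
      ∫ τ in Ioc 0 t, (-ν' * ‖X τ‖ ^ 2 + c' * γ τ) :=
    integral_mono_ae ((hHi.mono_set hsub).const_mul 2) (hgT.mono_set hsub)
      (ae_restrict_of_ae_restrict_of_subset hsub hpt)
  have e1 : ∫ τ in Ioc 0 t, 2 * ((-(4 * Real.pi ^ 2 : ℝ) : ℂ) * ⟪X τ, symbT (Visc4.conj G₀ 𝔸) k (X τ)⟫_ℂ +
      ((∑ j, (2 * Real.pi * I * (k j)) * ⟪F j τ, X τ⟫_ℂ) +
        (A : ℂ) * ∑ j, (2 * Real.pi * I * (k j)) * ⟪G j τ, X τ⟫_ℂ)).re =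
      2 * ∫ τ in Ioc 0 t, ((-(4 * Real.pi ^ 2 : ℝ) : ℂ) * ⟪X τ, symbT (Visc4.conj G₀ 𝔸) k (X τ)⟫_ℂ +
      ((∑ j, (2 * Real.pi * I * (k j)) * ⟪F j τ, X τ⟫_ℂ) +
        (A : ℂ) * ∑ j, (2 * Real.pi * I * (k j)) * ⟪G j τ, X τ⟫_ℂ)).re :=
    integral_const_mul _ _
  have e2 : ∫ τ in Ioc 0 t, (-ν' * ‖X τ‖ ^ 2 + c' * γ τ) =
      -ν' * (∫ τ in Ioc 0 t, ‖X τ‖ ^ 2) + c' * ∫ τ in Ioc 0 t, γ τ := by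
    rw [integral_add (haT.mono_set hsub) (hcT.mono_set hsub), integral_const_mul, integral_const_mul]
  rw [ht]
  linarith

/-- The identity frame `G₀ = 1`: the constant-frame modewise bound with `c = 1` is the flat one
(`Σ_a (twistFreq 1 k a)² = |k|²`, `𝔸^1 = 𝔸`) — consistency with
`IsWeakTensorPassiveVectorOn.ae_sq_norm_add_dissipation_le` through `of_one_toFlat`.
[cite: RobinsonRodrigoSadowski2016, §4.2 (4.20)] -/
theorem ae_sq_norm_add_dissipation_le_constFrame_one (h : IsWeakTensorPassiveVectorDistortedOn A T 𝔸 b (fun _ _ => (1 : Matrix d d ℝ)) w₀ w)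
    {lo hi : ℝ} (h𝔸 : NearIso 𝔸 lo hi) (hlo : 0 < lo)
    (hw₀ : MemLp w₀ 2 volume) (hdiv₀ : FunctionSpaces.Torus.IsWeaklyDivFree w₀)
    {M : ℝ} (hM : 0 ≤ M)
    (hbM : ∀ᵐ q ∂(((volume : Measure ℝ).restrict (Ioo 0 T)).prod (volume : Measure (UnitAddTorus d))),
      ‖b q.1 q.2‖ ≤ M) (k : d → ℤ) :
    ∀ᵐ t ∂(volume.restrict (Ioo 0 T)),
      ‖mFourierCoeff (FunctionSpaces.EuclideanSpace.complexify ∘ w t) k‖ ^ 2 +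
          4 * Real.pi ^ 2 * lo * FunctionSpaces.Torus.freqNormSq k *
            ∫ τ in Ioc 0 t, ‖mFourierCoeff (FunctionSpaces.EuclideanSpace.complexify ∘ w τ) k‖ ^ 2 ≤
        ‖mFourierCoeff (FunctionSpaces.EuclideanSpace.complexify ∘ w₀) k‖ ^ 2 +
          ((1 + A ^ 2) / lo) * ∫ τ in Ioc 0 t, ∑ j,
            (‖mFourierCoeff (FunctionSpaces.EuclideanSpace.complexify ∘ fun x => b τ x j • w τ x) k‖ ^ 2 +
              ‖mFourierCoeff (FunctionSpaces.EuclideanSpace.complexify ∘ fun x => w τ x j • b τ x) k‖ ^ 2) :=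
  h.of_one_toFlat.ae_sq_norm_add_dissipation_le h𝔸 hlo hw₀ hdiv₀ hM hbM k

end IsWeakTensorPassiveVectorDistortedOn

end ModeEnergy

end Torus

end Literature.Analysis.FluidPDE

end
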